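import Mathlib.RingTheory.Polynomial.IntegralNormalization
import Mathlib.RingTheory.Polynomial.ScaleRoots
import Mathlib.Algebra.Polynomial.Div
import Mathlib.Algebra.Polynomial.EraseLead
import Mathlib.Algebra.Polynomial.Derivative
import Mathlib.Analysis.Polynomial.Basic
import Mathlib.Analysis.Calculus.Deriv.Polynomial
import Mathlib.Analysis.Calculus.Deriv.MeanValue
import Mathlib.Data.Sign.Basic
import Mathlib.Topology.Algebra.Polynomial
import HarnessLib

/-!
# Sign diagrams of stable families of polynomials (Cohen–Hörmander elimination)

Support file for the discharge of the named fact `Literature.ModelTheory.ExponentialFields.tarski_seidenberg_real`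
(`Literature/ModelTheory/ExponentialFields/Semialgebraic.lean`: over `ℝ`, coordinate projections
of `k`-semialgebraic sets are `k`-semialgebraic; Bochnak–Coste–Roy Thm. 2.2.1, Basu–Pollack–Roy
Thm. 2.76), carried out in `Literature/ModelTheory/ExponentialFields/TarskiSeidenbergProofs.lean`.
This file contains the univariate real analysis and the parametric algebra of the elimination of
one variable, following P. J. Cohen's method ("Decision procedures for real and `p`-adic fields",
1969) in the form popularised by Hörmander and by Bochnak–Coste–Roy: the *sign diagram* of a
finite family of real polynomials closed under derivative and (pseudo-)remainders is a
combinatorial object which, for a family with polynomial coefficients, only depends on the signs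
of the coefficients. The bookkeeping of pseudo-remainders and truncations under specialization is
that of Basu–Pollack–Roy §1.3 (signed pseudo-remainder `PRem`, truncations `Tru`, the tree
`TRems`, and the remark `PRem(P_y, Q_y) = PRem(P, Truᵢ(Q))_y`, pp. 21–22); the univariate step is
the argument of Thom's lemma (Basu–Pollack–Roy Lemma 5.33: on a cell of a family containing `p'`,
`p` is monotone). No Sturm sequences, resultants or root continuity are used.

## Contents

* One real polynomial on an interval free of roots of its derivative: monotonicity, existence /
  uniqueness of a root and the signs around it in terms of the endpoint signs
  (`strictMonoOn_or_strictAntiOn`, `exists_root_Ioo_iff`, `sign_eq_of_root`, `sign_eq_of_no_root`).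
* Root sets `rts F` of finite families `F ⊆ ℝ[X]`, gaps (`below`, `above`), endpoint signs of a
  gap (`sigL`, `sigR`, with the signs at `±∞` for unbounded gaps) and the *gap lemmas*
  (`exists_root_gap_iff`, `root_gap_unique`, `sign_gap_of_root`, `sign_gap_of_no_root`).
* Correspondences between the root sets of two families of the same shape
  (`IsCorrespondence`, `IsoDiag`: "isomorphic sign diagrams") and the **extension theorem**
  `IsCorrespondence.isoDiag_insert`: adding a pair `(p, q)` of polynomials of the same degree,
  same sign of leading coefficient, derivatives in the families and equal signs at corresponding
  roots preserves the isomorphism. Consequence: realized simultaneous sign conditions transfer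
  (`IsoDiag.exists_sign_eq`).
* Over a commutative ring `A`: the scaled pseudo-remainder `sprem p q` (a variant of `PRem` with
  the identity `sprem p q (z) = lc(q) ^ deg p · p(z)` at every root `z` of every specialization of
  `q`, `eval₂_sprem`), *stable* finite families (`IsStable`: closed under derivative, truncation
  `eraseLead` and `sprem`), existence of finite stable families containing a given family
  (`exists_isStable_supset`), and the **parametric sign-diagram theorem** `isoDiag_specPairs`:
  two specializations `φ, ψ : A → ℝ` giving the same signs to all coefficients of a stable family
  give families with isomorphic sign diagrams; hence the same realizable sign conditions
  (`exists_forall_sign_eval_map_eq`). This is the analogue, for Cohen's method, of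
  Basu–Pollack–Roy Lemma 2.74 (realizability of sign conditions is determined by the signs of the
  leading coefficients of the pseudo-remainder data).

## References

* S. Basu, R. Pollack, M.-F. Roy, *Algorithms in Real Algebraic Geometry*, 2nd ed., Springer
  (2006): §1.3 (pp. 21–22: `PRem`, Notation 1.16 `Tru`, `TRems`, Notation 1.18), Prop. 2.27 and
  Lemma 5.33 (Thom's lemma), Lemma 2.74, Thm. 2.76 (projection theorem over a ring `D`).
* J. Bochnak, M. Coste, M.-F. Roy, *Real Algebraic Geometry*, Ergebnisse 36, Springer (1998),
  Thm. 2.2.1 (and the elimination of §1.4).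
* P. J. Cohen, Decision procedures for real and `p`-adic fields, Comm. Pure Appl. Math. 22
  (1969), 131–151.

## Design notes

* Everything univariate is over `ℝ` (the intermediate value and mean value theorems are taken
  from Mathlib); the parametric part is over an arbitrary commutative ring `A` with two ring
  homomorphisms `φ, ψ : A →+* ℝ` (in the application, `A = MvPolynomial (Fin n) k` and `φ, ψ` are
  evaluations at two points with the same coefficient signs).
* Signs are valued in Mathlib's `SignType`; a *correspondence* is an explicit map `e : ℝ → ℝ`
  which is a strictly monotone bijection between root sets, rather than an abstract isomorphism
  of ordered structures.
* Decidability: statements mentioning `Finset.image`/`erase` over `A[X]` assume `[DecidableEq A]`;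
  existence statements use `classical` in their proofs.
-/

noncomputable section

open Polynomial Set Filter

namespace Literature.ModelTheory.ExponentialFields

namespace SignDiagram

/-! ### Signs at `±∞` -/

/-- The sign of a real polynomial near `+∞`: the sign of its leading coefficient. [folklore] -/
def signTop (p : ℝ[X]) : SignType := SignType.sign p.leadingCoeff

/-- The sign of a real polynomial near `-∞`: `(-1)^(deg p)` times the sign of its leading
coefficient. [folklore] -/
def signBot (p : ℝ[X]) : SignType :=
  if Even p.natDegree then SignType.sign p.leadingCoeff else -SignType.sign p.leadingCoeff

/-- A non-constant real polynomial eventually has the sign of its leading coefficient at `+∞`.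
[folklore] -/
theorem eventually_atTop_sign_eq_signTop (p : ℝ[X]) (hp : 0 < p.natDegree) :
    ∀ᶠ x in atTop, SignType.sign (p.eval x) = signTop p := by
  have hdeg : 0 < p.degree := natDegree_pos_iff_degree_pos.mp hp
  have hlc : p.leadingCoeff ≠ 0 := leadingCoeff_ne_zero.mpr (ne_zero_of_natDegree_gt hp)
  rcases lt_or_gt_of_ne hlc with h | h
  · have ht := p.tendsto_atBot_of_leadingCoeff_nonpos hdeg h.le
    filter_upwards [ht.eventually (eventually_lt_atBot 0)] with x hx
    rw [signTop, sign_neg hx, sign_neg h]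
  · have ht := p.tendsto_atTop_of_leadingCoeff_nonneg hdeg h.le
    filter_upwards [ht.eventually (eventually_gt_atTop 0)] with x hx
    rw [signTop, sign_pos hx, sign_pos h]

/-- A non-constant real polynomial eventually has the sign `signBot` at `-∞`. [folklore] -/
theorem eventually_atBot_sign_eq_signBot (p : ℝ[X]) (hp : 0 < p.natDegree) :
    ∀ᶠ x in atBot, SignType.sign (p.eval x) = signBot p := by
  have h1 : 0 < (p.comp (-X)).natDegree := by simpa [natDegree_comp] using hp
  have h2 := (eventually_atTop_sign_eq_signTop (p.comp (-X)) h1)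
  have h3 := h2.filter_mono (le_refl _)
  have h4 : ∀ᶠ x in atBot, SignType.sign ((p.comp (-X)).eval (-x)) = signTop (p.comp (-X)) :=
    tendsto_neg_atBot_atTop.eventually h2
  filter_upwards [h4] with x hx
  simp only [eval_comp, eval_neg, eval_X, neg_neg] at hx
  rw [hx, signTop, signBot, comp_neg_X_leadingCoeff_eq]
  rcases Nat.even_or_odd p.natDegree with he | ho
  · simp [he, he.neg_one_pow]
  · simp [ho.neg_one_pow, Nat.not_even_iff_odd.mpr ho, Left.sign_neg]

/-! ### One polynomial on one closed interval -/

section Interval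

variable {p : ℝ[X]} {a b : ℝ}

/-- IVT for polynomials, increasing version. [folklore] -/
theorem exists_root_of_neg_of_pos (hab : a ≤ b) (ha : p.eval a < 0) (hb : 0 < p.eval b) :
    ∃ r ∈ Ioo a b, p.eval r = 0 := by
  have := intermediate_value_Ioo hab (p.continuousOn (s := Icc a b))
  exact this ⟨ha, hb⟩

/-- IVT for polynomials, decreasing version. [folklore] -/
theorem exists_root_of_pos_of_neg (hab : a ≤ b) (ha : 0 < p.eval a) (hb : p.eval b < 0) :
    ∃ r ∈ Ioo a b, p.eval r = 0 := by
  have := intermediate_value_Ioo' hab (p.continuousOn (s := Icc a b))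
  exact this ⟨hb, ha⟩

/-- If a polynomial does not vanish on `[a, b]` then it has the same sign at `a` and `b`.
[folklore] -/
theorem sign_eq_sign_of_forall_ne_zero (hab : a ≤ b) (h : ∀ z ∈ Icc a b, p.eval z ≠ 0) :
    SignType.sign (p.eval a) = SignType.sign (p.eval b) := by
  have ha : p.eval a ≠ 0 := h a (left_mem_Icc.mpr hab)
  have hb : p.eval b ≠ 0 := h b (right_mem_Icc.mpr hab)
  rcases lt_or_gt_of_ne ha with ha' | ha' <;> rcases lt_or_gt_of_ne hb with hb' | hb'
  · rw [sign_neg ha', sign_neg hb']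
  · obtain ⟨r, hr, hr0⟩ := exists_root_of_neg_of_pos hab ha' hb'
    exact absurd hr0 (h r (Ioo_subset_Icc_self hr))
  · obtain ⟨r, hr, hr0⟩ := exists_root_of_pos_of_neg hab ha' hb'
    exact absurd hr0 (h r (Ioo_subset_Icc_self hr))
  · rw [sign_pos ha', sign_pos hb']

/-- A polynomial whose derivative does not vanish on `(a, b)` is strictly monotone or strictly
antitone on `[a, b]`. [folklore] -/
theorem strictMonoOn_or_strictAntiOn (hab : a < b)
    (h : ∀ z ∈ Ioo a b, p.derivative.eval z ≠ 0) :
    StrictMonoOn (fun x => p.eval x) (Icc a b) ∨ StrictAntiOn (fun x => p.eval x) (Icc a b) := by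
  -- the derivative has constant sign on `(a, b)`
  set m : ℝ := (a + b) / 2 with hm
  have hmI : m ∈ Ioo a b := ⟨by rw [hm]; linarith, by rw [hm]; linarith⟩
  have hconst : ∀ z ∈ Ioo a b,
      SignType.sign (p.derivative.eval z) = SignType.sign (p.derivative.eval m) := by
    intro z hz
    rcases le_total z m with hzm | hmz
    · exact sign_eq_sign_of_forall_ne_zero hzm fun w hw =>
        h w ⟨hz.1.trans_le hw.1, hw.2.trans_lt hmI.2⟩
    · exact (sign_eq_sign_of_forall_ne_zero hmz fun w hw =>
        h w ⟨hmI.1.trans_le hw.1, hw.2.trans_lt hz.2⟩).symm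
  rcases lt_or_gt_of_ne (h m hmI) with hneg | hpos
  · right
    refine strictAntiOn_of_deriv_neg (convex_Icc a b) p.continuousOn fun x hx => ?_
    rw [interior_Icc] at hx
    rw [Polynomial.deriv]
    have := hconst x hx
    rw [sign_neg hneg] at this
    exact sign_eq_neg_one_iff.mp this
  · left
    refine strictMonoOn_of_deriv_pos (convex_Icc a b) p.continuousOn fun x hx => ?_
    rw [interior_Icc] at hx
    rw [Polynomial.deriv]
    have := hconst x hx
    rw [sign_pos hpos] at this
    exact sign_eq_one_iff.mp this

/-- **Interval lemma, root existence.** For a polynomial strictly monotone or antitone on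
`[a, b]`, there is a root in `(a, b)` iff the signs at the endpoints are non-zero and opposite.
[folklore] -/
theorem exists_root_Ioo_iff (hab : a < b)
    (hmono : StrictMonoOn (fun x => p.eval x) (Icc a b) ∨
      StrictAntiOn (fun x => p.eval x) (Icc a b)) :
    (∃ r ∈ Ioo a b, p.eval r = 0) ↔
      (SignType.sign (p.eval a) = -SignType.sign (p.eval b) ∧ SignType.sign (p.eval a) ≠ 0) := by
  have haI : a ∈ Icc a b := left_mem_Icc.mpr hab.le
  have hbI : b ∈ Icc a b := right_mem_Icc.mpr hab.le
  constructor
  · rintro ⟨r, hr, hr0⟩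
    have hrI : r ∈ Icc a b := Ioo_subset_Icc_self hr
    rcases hmono with hmono | hmono
    · have h1 : p.eval a < p.eval r := hmono haI hrI hr.1
      have h2 : p.eval r < p.eval b := hmono hrI hbI hr.2
      rw [hr0] at h1 h2
      simp [sign_neg h1, sign_pos h2]
    · have h1 : p.eval r < p.eval a := hmono haI hrI hr.1
      have h2 : p.eval b < p.eval r := hmono hrI hbI hr.2
      rw [hr0] at h1 h2
      simp [sign_pos h1, sign_neg h2]
  · rintro ⟨hopp, hne⟩
    have ha0 : p.eval a ≠ 0 := fun h => hne (by rw [h, sign_zero])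
    rcases lt_or_gt_of_ne ha0 with ha' | ha'
    · rw [sign_neg ha'] at hopp
      have hb' : 0 < p.eval b := sign_eq_one_iff.mp (by
        rcases lt_trichotomy (p.eval b) 0 with h | h | h
        · rw [sign_neg h] at hopp; exact absurd hopp (by decide)
        · rw [h, sign_zero] at hopp; exact absurd hopp (by decide)
        · exact sign_pos h)
      exact exists_root_of_neg_of_pos hab.le ha' hb'
    · rw [sign_pos ha'] at hopp
      have hb' : p.eval b < 0 := sign_eq_neg_one_iff.mp (by
        rcases lt_trichotomy (p.eval b) 0 with h | h | h
        · exact sign_neg h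
        · rw [h, sign_zero] at hopp; exact absurd hopp (by decide)
        · rw [sign_pos h] at hopp; exact absurd hopp (by decide))
      exact exists_root_of_pos_of_neg hab.le ha' hb'

/-- **Interval lemma, uniqueness.** [folklore] -/
theorem root_unique (hmono : StrictMonoOn (fun x => p.eval x) (Icc a b) ∨
      StrictAntiOn (fun x => p.eval x) (Icc a b))
    {r₁ r₂ : ℝ} (h₁ : r₁ ∈ Icc a b) (h₂ : r₂ ∈ Icc a b) (hr₁ : p.eval r₁ = 0)
    (hr₂ : p.eval r₂ = 0) : r₁ = r₂ := by
  rcases hmono with hmono | hmono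
  · exact hmono.injOn h₁ h₂ (hr₁.trans hr₂.symm)
  · exact hmono.injOn h₁ h₂ (hr₁.trans hr₂.symm)

/-- **Interval lemma, signs left and right of the root.** [folklore] -/
theorem sign_eq_of_root (hab : a < b)
    (hmono : StrictMonoOn (fun x => p.eval x) (Icc a b) ∨
      StrictAntiOn (fun x => p.eval x) (Icc a b))
    {r y : ℝ} (hr : r ∈ Ioo a b) (hr0 : p.eval r = 0) (hy : y ∈ Ioo a b) (hy0 : p.eval y ≠ 0) :
    SignType.sign (p.eval y) =
      if y < r then SignType.sign (p.eval a) else SignType.sign (p.eval b) := by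
  have haI : a ∈ Icc a b := left_mem_Icc.mpr hab.le
  have hbI : b ∈ Icc a b := right_mem_Icc.mpr hab.le
  have hrI : r ∈ Icc a b := Ioo_subset_Icc_self hr
  have hyI : y ∈ Icc a b := Ioo_subset_Icc_self hy
  have hyr : y ≠ r := fun h => hy0 (h ▸ hr0)
  rcases hmono with hmono | hmono
  · have h1 : p.eval a < p.eval r := hmono haI hrI hr.1
    have h2 : p.eval r < p.eval b := hmono hrI hbI hr.2
    rw [hr0] at h1 h2
    split_ifs with hlt
    · have : p.eval y < p.eval r := hmono hyI hrI hlt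
      rw [hr0] at this
      rw [sign_neg this, sign_neg h1]
    · have hlt' : r < y := lt_of_le_of_ne (not_lt.mp hlt) hyr.symm
      have : p.eval r < p.eval y := hmono hrI hyI hlt'
      rw [hr0] at this
      rw [sign_pos this, sign_pos h2]
  · have h1 : p.eval r < p.eval a := hmono haI hrI hr.1
    have h2 : p.eval b < p.eval r := hmono hrI hbI hr.2
    rw [hr0] at h1 h2
    split_ifs with hlt
    · have : p.eval r < p.eval y := hmono hyI hrI hlt
      rw [hr0] at this
      rw [sign_pos this, sign_pos h1]
    · have hlt' : r < y := lt_of_le_of_ne (not_lt.mp hlt) hyr.symm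
      have : p.eval y < p.eval r := hmono hrI hyI hlt'
      rw [hr0] at this
      rw [sign_neg this, sign_neg h2]

/-- **Interval lemma, sign when there is no root.** [folklore] -/
theorem sign_eq_of_no_root (hab : a < b)
    (hmono : StrictMonoOn (fun x => p.eval x) (Icc a b) ∨
      StrictAntiOn (fun x => p.eval x) (Icc a b))
    (hno : ∀ r ∈ Ioo a b, p.eval r ≠ 0) {y : ℝ} (hy : y ∈ Ioo a b) :
    SignType.sign (p.eval y) =
      if SignType.sign (p.eval a) ≠ 0 then SignType.sign (p.eval a)
      else SignType.sign (p.eval b) := by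
  have haI : a ∈ Icc a b := left_mem_Icc.mpr hab.le
  have hbI : b ∈ Icc a b := right_mem_Icc.mpr hab.le
  have hyI : y ∈ Icc a b := Ioo_subset_Icc_self hy
  -- no root on `[a, y]` except possibly at `a`, none on `[y, b]` except possibly at `b`
  split_ifs with ha
  · -- sign at y equals sign at a: no root in `[a, y]`
    have ha0 : p.eval a ≠ 0 := sign_ne_zero.mp ha
    exact (sign_eq_sign_of_forall_ne_zero hy.1.le fun z hz => by
      rcases eq_or_lt_of_le hz.1 with h | h
      · exact h ▸ ha0
      · exact hno z ⟨h, hz.2.trans_lt hy.2⟩).symm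
  · have ha0 : p.eval a = 0 := by simpa [sign_eq_zero_iff] using ha
    -- then `b` is not a root (strict monotonicity) and no root in `[y, b]`
    have hb0 : p.eval b ≠ 0 := by
      intro hb0
      have := root_unique hmono haI hbI ha0 hb0
      exact hab.ne this
    exact sign_eq_sign_of_forall_ne_zero hy.2.le fun z hz => by
      rcases eq_or_lt_of_le hz.2 with h | h
      · exact h ▸ hb0
      · exact hno z ⟨hy.1.trans_le hz.1, h⟩

end Interval

/-! ### Root sets, gaps and endpoint signs of a finite family -/

section Family

/-- The set of real roots of the non-zero members of a finite family of real polynomials.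
[folklore] -/
def rts (F : Finset ℝ[X]) : Finset ℝ := F.biUnion fun f => f.roots.toFinset

/-- Membership in the root set of a family. [folklore] -/
theorem mem_rts {F : Finset ℝ[X]} {z : ℝ} : z ∈ rts F ↔ ∃ f ∈ F, f ≠ 0 ∧ f.eval z = 0 := by
  simp [rts, Multiset.mem_toFinset, mem_roots', IsRoot.def]

/-- The root set is monotone in the family. [folklore] -/
theorem rts_mono {F G : Finset ℝ[X]} (h : F ⊆ G) : rts F ⊆ rts G := fun z hz => by
  obtain ⟨f, hf, hf0, hfz⟩ := mem_rts.mp hz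
  exact mem_rts.mpr ⟨f, h hf, hf0, hfz⟩

/-- The roots of the family lying strictly below `y`. [folklore] -/
def below (F : Finset ℝ[X]) (y : ℝ) : Finset ℝ := (rts F).filter (· < y)

/-- The roots of the family lying strictly above `y`. [folklore] -/
def above (F : Finset ℝ[X]) (y : ℝ) : Finset ℝ := (rts F).filter (fun z => y < z)

/-- Membership in `below`. [folklore] -/
theorem mem_below {F : Finset ℝ[X]} {y z : ℝ} : z ∈ below F y ↔ z ∈ rts F ∧ z < y := by
  simp [below]

/-- Membership in `above`. [folklore] -/
theorem mem_above {F : Finset ℝ[X]} {y z : ℝ} : z ∈ above F y ↔ z ∈ rts F ∧ y < z := by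
  simp [above]

/-- Two points have the same roots of the family below them iff no root separates them.
[folklore] -/
theorem below_eq_below_iff {F : Finset ℝ[X]} {w y : ℝ} :
    below F w = below F y ↔ ∀ z ∈ rts F, (z < w ↔ z < y) := by
  constructor
  · intro h z hz
    constructor
    · intro hzw; exact (mem_below.mp (h ▸ mem_below.mpr ⟨hz, hzw⟩)).2
    · intro hzy; exact (mem_below.mp (h.symm ▸ mem_below.mpr ⟨hz, hzy⟩)).2
  · intro h
    ext z
    simp only [mem_below]
    exact ⟨fun hz => ⟨hz.1, (h z hz.1).mp hz.2⟩, fun hz => ⟨hz.1, (h z hz.1).mpr hz.2⟩⟩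

/-- Sign of `p` at the left end of the gap of `y`: at the largest root of the family below `y`,
or at `-∞` if there is none. [folklore] -/
def sigL (F : Finset ℝ[X]) (p : ℝ[X]) (y : ℝ) : SignType :=
  if h : (below F y).Nonempty then SignType.sign (p.eval ((below F y).max' h)) else signBot p

/-- Sign of `p` at the right end of the gap of `y`: at the smallest root of the family above `y`,
or at `+∞` if there is none. [folklore] -/
def sigR (F : Finset ℝ[X]) (p : ℝ[X]) (y : ℝ) : SignType :=
  if h : (above F y).Nonempty then SignType.sign (p.eval ((above F y).min' h)) else signTop p

variable {F : Finset ℝ[X]} {p : ℝ[X]}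

/-- Two non-roots with the same roots below them have the same roots above them. [folklore] -/
theorem above_eq_of_below_eq {y w : ℝ} (hy : y ∉ rts F) (hw : w ∉ rts F)
    (h : below F w = below F y) : above F w = above F y := by
  ext z
  simp only [mem_above]
  constructor
  · rintro ⟨hz, hwz⟩
    refine ⟨hz, ?_⟩
    by_contra hzy
    have hzy' : z < y := lt_of_le_of_ne (not_lt.mp hzy) (fun h' => hy (h' ▸ hz))
    have : z ∈ below F w := h ▸ mem_below.mpr ⟨hz, hzy'⟩
    exact absurd (mem_below.mp this).2 (not_lt.mpr hwz.le)
  · rintro ⟨hz, hyz⟩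
    refine ⟨hz, ?_⟩
    by_contra hzw
    have hzw' : z < w := lt_of_le_of_ne (not_lt.mp hzw) (fun h' => hw (h' ▸ hz))
    have : z ∈ below F y := h.symm ▸ mem_below.mpr ⟨hz, hzw'⟩
    exact absurd (mem_below.mp this).2 (not_lt.mpr hyz.le)

/-- `sigL` only depends on the gap. [folklore] -/
theorem sigL_congr {y w : ℝ} (h : below F w = below F y) : sigL F p w = sigL F p y := by
  simp only [sigL, h]

/-- `sigR` only depends on the gap (for non-roots). [folklore] -/
theorem sigR_congr {y w : ℝ} (hy : y ∉ rts F) (hw : w ∉ rts F) (h : below F w = below F y) :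
    sigR F p w = sigR F p y := by
  simp only [sigR, above_eq_of_below_eq hy hw h]

/-- A common bound for the roots of the family, the roots of `p`, and the thresholds beyond which
`p` has its signs at `±∞`. [folklore] -/
theorem exists_bound (F : Finset ℝ[X]) (p : ℝ[X]) (hp : 0 < p.natDegree) :
    ∃ M : ℝ, 0 < M ∧ (∀ z ∈ rts F, -M < z ∧ z < M) ∧ (∀ r, p.eval r = 0 → -M < r ∧ r < M) ∧
      (∀ x, M ≤ x → SignType.sign (p.eval x) = signTop p) ∧
      (∀ x, x ≤ -M → SignType.sign (p.eval x) = signBot p) := by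
  have hp0 : p ≠ 0 := ne_zero_of_natDegree_gt hp
  obtain ⟨T₁, hT₁⟩ := Filter.eventually_atTop.mp (eventually_atTop_sign_eq_signTop p hp)
  obtain ⟨T₂, hT₂⟩ := Filter.eventually_atBot.mp (eventually_atBot_sign_eq_signBot p hp)
  set Q : Finset ℝ := rts F ∪ p.roots.toFinset with hQ
  obtain ⟨B₁, hB₁⟩ := Finset.exists_le (Q.image fun x => |x|)
  refine ⟨max (max (B₁ + 1) 1) (max T₁ (-T₂)), ?_, ?_, ?_, ?_, ?_⟩
  · exact lt_max_of_lt_left (lt_max_of_lt_right one_pos)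
  · intro z hz
    have : |z| ≤ B₁ := hB₁ _ (Finset.mem_image_of_mem _ (Finset.mem_union_left _ hz))
    have h1 : |z| < max (max (B₁ + 1) 1) (max T₁ (-T₂)) :=
      lt_max_of_lt_left (lt_max_of_lt_left (by linarith))
    exact abs_lt.mp h1
  · intro r hr
    have hrQ : r ∈ Q := Finset.mem_union_right _
      (Multiset.mem_toFinset.mpr ((mem_roots hp0).mpr hr))
    have : |r| ≤ B₁ := hB₁ _ (Finset.mem_image_of_mem _ hrQ)
    have h1 : |r| < max (max (B₁ + 1) 1) (max T₁ (-T₂)) :=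
      lt_max_of_lt_left (lt_max_of_lt_left (by linarith))
    exact abs_lt.mp h1
  · intro x hx
    exact hT₁ x (le_trans (le_max_of_le_right (le_max_left _ _)) hx)
  · intro x hx
    refine hT₂ x ?_
    have : -T₂ ≤ max (max (B₁ + 1) 1) (max T₁ (-T₂)) := le_max_of_le_right (le_max_right _ _)
    linarith

/-- **Frame of a gap.** Around a non-root `y` of the family there is a closed interval `[a, b]`
containing `y` in its interior, containing no root of the family in its interior, on which `p` is
strictly monotone or antitone, whose endpoint signs are `sigL`, `sigR`, and which contains all
roots of `p` in the gap of `y`. Hypotheses: `p` has positive degree and the roots of `p'` are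
roots of the family. [cite: BasuPollackRoy2006, Lemma 5.33 (Thom's lemma), proof] -/
theorem exists_frame (hp : 0 < p.natDegree) (hd : ∀ r, p.derivative.eval r = 0 → r ∈ rts F)
    {y : ℝ} (hy : y ∉ rts F) :
    ∃ a b : ℝ, a < y ∧ y < b ∧ (∀ z ∈ rts F, ¬(a < z ∧ z < b)) ∧
      (StrictMonoOn (fun x => p.eval x) (Icc a b) ∨ StrictAntiOn (fun x => p.eval x) (Icc a b)) ∧
      SignType.sign (p.eval a) = sigL F p y ∧ SignType.sign (p.eval b) = sigR F p y ∧
      (∀ w, a < w → w < b → w ∉ rts F → below F w = below F y) ∧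
      (∀ r, r ∉ rts F → p.eval r = 0 → below F r = below F y → a < r ∧ r < b) := by
  obtain ⟨M₀, hM₀, hZ, hR, hT, hB⟩ := exists_bound F p hp
  set M : ℝ := max M₀ (|y| + 1) with hM
  have hMM₀ : M₀ ≤ M := le_max_left _ _
  have hyM : |y| < M := lt_of_lt_of_le (by linarith) (le_max_right _ _)
  set a : ℝ := if h : (below F y).Nonempty then (below F y).max' h else -M with ha
  set b : ℝ := if h : (above F y).Nonempty then (above F y).min' h else M with hb
  have hay : a < y := by
    rw [ha]
    split_ifs with h
    · exact (mem_below.mp (Finset.max'_mem _ h)).2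
    · have := (abs_lt.mp hyM).1; linarith
  have hyb : y < b := by
    rw [hb]
    split_ifs with h
    · exact (mem_above.mp (Finset.min'_mem _ h)).2
    · exact (abs_lt.mp hyM).2
  have hnoZ : ∀ z ∈ rts F, ¬(a < z ∧ z < b) := by
    rintro z hz ⟨haz, hzb⟩
    rcases lt_trichotomy z y with hzy | rfl | hyz
    · have hzb' : z ∈ below F y := mem_below.mpr ⟨hz, hzy⟩
      have hne : (below F y).Nonempty := ⟨z, hzb'⟩
      have : a = (below F y).max' hne := by rw [ha, dif_pos hne]
      exact absurd (this ▸ haz) (not_lt.mpr (Finset.le_max' _ z hzb'))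
    · exact hy hz
    · have hza' : z ∈ above F y := mem_above.mpr ⟨hz, hyz⟩
      have hne : (above F y).Nonempty := ⟨z, hza'⟩
      have : b = (above F y).min' hne := by rw [hb, dif_pos hne]
      exact absurd (this ▸ hzb) (not_lt.mpr (Finset.min'_le _ z hza'))
  have hmono : StrictMonoOn (fun x => p.eval x) (Icc a b) ∨
      StrictAntiOn (fun x => p.eval x) (Icc a b) :=
    strictMonoOn_or_strictAntiOn (hay.trans hyb) fun z hz h0 => hnoZ z (hd z h0) hz
  refine ⟨a, b, hay, hyb, hnoZ, hmono, ?_, ?_, ?_, ?_⟩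
  · -- sign at `a`
    rw [sigL]
    split_ifs with h
    · rw [ha, dif_pos h]
    · rw [ha, dif_neg h]
      exact hB _ (by linarith)
  · -- sign at `b`
    rw [sigR]
    split_ifs with h
    · rw [hb, dif_pos h]
    · rw [hb, dif_neg h]
      exact hT _ hMM₀
  · -- points of `(a, b)` off the root set are in the gap of `y`
    intro w haw hwb hw
    ext z
    simp only [mem_below]
    constructor
    · rintro ⟨hz, hzw⟩
      refine ⟨hz, ?_⟩
      by_contra hzy
      have hyz : y < z := lt_of_le_of_ne (not_lt.mp hzy) fun h' => hy (h' ▸ hz)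
      exact hnoZ z hz ⟨hay.trans hyz, hzw.trans hwb⟩
    · rintro ⟨hz, hzy⟩
      refine ⟨hz, ?_⟩
      by_contra hzw
      have hwz : w < z := lt_of_le_of_ne (not_lt.mp hzw) fun h' => hw (h' ▸ hz)
      exact hnoZ z hz ⟨haw.trans hwz, hzy.trans hyb⟩
  · -- roots of `p` in the gap of `y` lie in `(a, b)`
    intro r hr hr0 hbr
    constructor
    · rw [ha]
      split_ifs with h
      · have : (below F y).max' h ∈ below F r := hbr.symm ▸ Finset.max'_mem _ h
        exact (mem_below.mp this).2
      · have := (hR r hr0).1; linarith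
    · rw [hb]
      split_ifs with h
      · have hbZ : (above F y).min' h ∈ rts F := (mem_above.mp (Finset.min'_mem _ h)).1
        have hyb' : y < (above F y).min' h := (mem_above.mp (Finset.min'_mem _ h)).2
        have hnot : (above F y).min' h ∉ below F r := by
          rw [hbr]; exact fun h' => absurd (mem_below.mp h').2 (not_lt.mpr hyb'.le)
        have hle : r ≤ (above F y).min' h := by
          by_contra hlt
          exact hnot (mem_below.mpr ⟨hbZ, not_le.mp hlt⟩)
        exact lt_of_le_of_ne hle fun h' => hr (h' ▸ hbZ)
      · exact lt_of_lt_of_le (hR r hr0).2 hMM₀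

/-- **Gap lemma (C1).** A root of `p` in the gap of the non-root `y` exists iff the endpoint signs
of the gap are non-zero and opposite.
[cite: BasuPollackRoy2006, Lemma 5.33 (Thom's lemma), proof] -/
theorem exists_root_gap_iff (hp : 0 < p.natDegree) (hd : ∀ r, p.derivative.eval r = 0 → r ∈ rts F)
    {y : ℝ} (hy : y ∉ rts F) :
    (∃ r, r ∉ rts F ∧ below F r = below F y ∧ p.eval r = 0) ↔
      (sigL F p y = -sigR F p y ∧ sigL F p y ≠ 0) := by
  obtain ⟨a, b, hay, hyb, hnoZ, hmono, hsa, hsb, hgap, hroot⟩ := exists_frame hp hd hy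
  rw [← hsa, ← hsb, ← exists_root_Ioo_iff (hay.trans hyb) hmono]
  constructor
  · rintro ⟨r, hr, hbr, hr0⟩
    exact ⟨r, hroot r hr hr0 hbr, hr0⟩
  · rintro ⟨r, hr, hr0⟩
    have hrZ : r ∉ rts F := fun h => hnoZ r h hr
    exact ⟨r, hrZ, hgap r hr.1 hr.2 hrZ, hr0⟩

/-- **Gap lemma (C1, uniqueness).** `p` has at most one root in each gap.
[cite: BasuPollackRoy2006, Lemma 5.33 (Thom's lemma), proof] -/
theorem root_gap_unique (hp : 0 < p.natDegree) (hd : ∀ r, p.derivative.eval r = 0 → r ∈ rts F)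
    {r₁ r₂ : ℝ} (h₁ : r₁ ∉ rts F) (h₂ : r₂ ∉ rts F) (h : below F r₂ = below F r₁)
    (hr₁ : p.eval r₁ = 0) (hr₂ : p.eval r₂ = 0) : r₁ = r₂ := by
  obtain ⟨a, b, hay, hyb, -, hmono, -, -, -, hroot⟩ := exists_frame hp hd h₁
  have := hroot r₂ h₂ hr₂ h
  exact root_unique hmono ⟨hay.le, hyb.le⟩ ⟨this.1.le, this.2.le⟩ hr₁ hr₂

/-- **Gap lemma (C2a).** Sign of `p` at a non-root `y` whose gap contains a root `r` of `p`.
[cite: BasuPollackRoy2006, Lemma 5.33 (Thom's lemma), proof] -/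
theorem sign_gap_of_root (hp : 0 < p.natDegree) (hd : ∀ r, p.derivative.eval r = 0 → r ∈ rts F)
    {y r : ℝ} (hy : y ∉ rts F) (hy0 : p.eval y ≠ 0) (hr : r ∉ rts F) (h : below F r = below F y)
    (hr0 : p.eval r = 0) :
    SignType.sign (p.eval y) = if y < r then sigL F p y else sigR F p y := by
  obtain ⟨a, b, hay, hyb, -, hmono, hsa, hsb, -, hroot⟩ := exists_frame hp hd hy
  rw [← hsa, ← hsb]
  exact sign_eq_of_root (hay.trans hyb) hmono (hroot r hr hr0 h) hr0 ⟨hay, hyb⟩ hy0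

/-- **Gap lemma (C2b).** Sign of `p` at a non-root `y` whose gap contains no root of `p`.
[cite: BasuPollackRoy2006, Lemma 5.33 (Thom's lemma), proof] -/
theorem sign_gap_of_no_root (hp : 0 < p.natDegree)
    (hd : ∀ r, p.derivative.eval r = 0 → r ∈ rts F) {y : ℝ} (hy : y ∉ rts F)
    (hno : ∀ r, r ∉ rts F → below F r = below F y → p.eval r ≠ 0) :
    SignType.sign (p.eval y) = if sigL F p y ≠ 0 then sigL F p y else sigR F p y := by
  obtain ⟨a, b, hay, hyb, hnoZ, hmono, hsa, hsb, hgap, -⟩ := exists_frame hp hd hy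
  rw [← hsa, ← hsb]
  refine sign_eq_of_no_root (hay.trans hyb) hmono (fun r hr hr0 => ?_) ⟨hay, hyb⟩
  have hrZ : r ∉ rts F := fun h' => hnoZ r h' hr
  exact hno r hrZ (hgap r hr.1 hr.2 hrZ) hr0

end Family

/-! ### Correspondences between two families -/

section Pairs

/-- A point strictly between two finite sets of reals lying one below the other. [folklore] -/
theorem exists_between_finsets (B A : Finset ℝ) (h : ∀ b ∈ B, ∀ a ∈ A, b < a) :
    ∃ y : ℝ, (∀ b ∈ B, b < y) ∧ (∀ a ∈ A, y < a) := by
  by_cases hB : B.Nonempty <;> by_cases hA : A.Nonempty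
  · refine ⟨(B.max' hB + A.min' hA) / 2, fun b hb => ?_, fun a ha => ?_⟩
    · have h1 : b ≤ B.max' hB := Finset.le_max' _ _ hb
      have h2 : B.max' hB < A.min' hA := h _ (Finset.max'_mem _ _) _ (Finset.min'_mem _ _)
      linarith
    · have h1 : A.min' hA ≤ a := Finset.min'_le _ _ ha
      have h2 : B.max' hB < A.min' hA := h _ (Finset.max'_mem _ _) _ (Finset.min'_mem _ _)
      linarith
  · refine ⟨B.max' hB + 1, fun b hb => ?_, fun a ha => absurd ⟨a, ha⟩ hA⟩
    have h1 : b ≤ B.max' hB := Finset.le_max' _ _ hb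
    linarith
  · refine ⟨A.min' hA - 1, fun b hb => absurd ⟨b, hb⟩ hB, fun a ha => ?_⟩
    have h1 : A.min' hA ≤ a := Finset.min'_le _ _ ha
    linarith
  · exact ⟨0, fun b hb => absurd ⟨b, hb⟩ hB, fun a ha => absurd ⟨a, ha⟩ hA⟩

/-- The family of first components of a finite family of pairs of polynomials. [folklore] -/
def fam₁ (S : Finset (ℝ[X] × ℝ[X])) : Finset ℝ[X] := S.image Prod.fst

/-- The family of second components of a finite family of pairs of polynomials. [folklore] -/
def fam₂ (S : Finset (ℝ[X] × ℝ[X])) : Finset ℝ[X] := S.image Prod.snd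

/-- `fam₁` of an insertion. [folklore] -/
theorem fam₁_insert (S : Finset (ℝ[X] × ℝ[X])) (p q : ℝ[X]) :
    fam₁ (insert (p, q) S) = insert p (fam₁ S) := by
  simp [fam₁, Finset.image_insert]

/-- `fam₂` of an insertion. [folklore] -/
theorem fam₂_insert (S : Finset (ℝ[X] × ℝ[X])) (p q : ℝ[X]) :
    fam₂ (insert (p, q) S) = insert q (fam₂ S) := by
  simp [fam₂, Finset.image_insert]

/-- First components belong to `fam₁`. [folklore] -/
theorem fst_mem_fam₁ {S : Finset (ℝ[X] × ℝ[X])} {pr : ℝ[X] × ℝ[X]} (h : pr ∈ S) : pr.1 ∈ fam₁ S :=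
  Finset.mem_image_of_mem _ h

/-- Second components belong to `fam₂`. [folklore] -/
theorem snd_mem_fam₂ {S : Finset (ℝ[X] × ℝ[X])} {pr : ℝ[X] × ℝ[X]} (h : pr ∈ S) : pr.2 ∈ fam₂ S :=
  Finset.mem_image_of_mem _ h

/-- Root set of a family with one more member. [folklore] -/
theorem mem_rts_insert {F : Finset ℝ[X]} {p : ℝ[X]} {z : ℝ} :
    z ∈ rts (insert p F) ↔ (p ≠ 0 ∧ p.eval z = 0) ∨ z ∈ rts F := by
  simp [rts, Finset.biUnion_insert, Multiset.mem_toFinset, mem_roots', IsRoot.def]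

/-- Enlarging the family enlarges the root set. [folklore] -/
theorem rts_subset_rts_insert (F : Finset ℝ[X]) (p : ℝ[X]) : rts F ⊆ rts (insert p F) :=
  rts_mono (Finset.subset_insert _ _)

/-- Two points `y`, `y'` occupy corresponding positions with respect to a map `e` on a finite set
`Z`: the elements of `Z` below `y` are exactly those mapped below `y'`. [folklore] -/
def Corr (e : ℝ → ℝ) (Z : Finset ℝ) (y y' : ℝ) : Prop := ∀ z ∈ Z, z < y ↔ e z < y'

/-- A **correspondence** between the two families of a finite family of pairs `S`: an
order-preserving bijection `e` from the root set of the first components onto that of the second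
components, matching the signs of each pair at corresponding roots and on corresponding gaps.
This is the combinatorial content of "the two families have the same sign diagram". [folklore] -/
structure IsCorrespondence (S : Finset (ℝ[X] × ℝ[X])) (e : ℝ → ℝ) : Prop where
  bijOn : Set.BijOn e (rts (fam₁ S)) (rts (fam₂ S))
  strictMonoOn : StrictMonoOn e (rts (fam₁ S))
  sign_root : ∀ pr ∈ S, ∀ z ∈ rts (fam₁ S),
    SignType.sign (pr.1.eval z) = SignType.sign (pr.2.eval (e z))
  sign_gap : ∀ pr ∈ S, ∀ y y', y ∉ rts (fam₁ S) → y' ∉ rts (fam₂ S) →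
    Corr e (rts (fam₁ S)) y y' → SignType.sign (pr.1.eval y) = SignType.sign (pr.2.eval y')

/-- Two families of pairs have **isomorphic sign diagrams** if there is a correspondence.
[folklore] -/
def IsoDiag (S : Finset (ℝ[X] × ℝ[X])) : Prop := ∃ e, IsCorrespondence S e

namespace IsCorrespondence

variable {S : Finset (ℝ[X] × ℝ[X])} {e : ℝ → ℝ}

/-- A correspondence maps roots to roots. [folklore] -/
theorem mem_of_mem (h : IsCorrespondence S e) {z : ℝ} (hz : z ∈ rts (fam₁ S)) :
    e z ∈ rts (fam₂ S) := h.bijOn.mapsTo hz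

/-- A correspondence preserves and reflects `<` on roots. [folklore] -/
theorem lt_iff_lt (h : IsCorrespondence S e) {z w : ℝ} (hz : z ∈ rts (fam₁ S))
    (hw : w ∈ rts (fam₁ S)) : e z < e w ↔ z < w :=
  h.strictMonoOn.lt_iff_lt hz hw

/-- A correspondence preserves and reflects `≤` on roots. [folklore] -/
theorem le_iff_le (h : IsCorrespondence S e) {z w : ℝ} (hz : z ∈ rts (fam₁ S))
    (hw : w ∈ rts (fam₁ S)) : e z ≤ e w ↔ z ≤ w :=
  h.strictMonoOn.le_iff_le hz hw

/-- Every gap of the first family corresponds to a (non-empty) gap of the second. [folklore] -/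
theorem exists_corr (h : IsCorrespondence S e) (y : ℝ) :
    ∃ y', y' ∉ rts (fam₂ S) ∧ Corr e (rts (fam₁ S)) y y' := by
  classical
  set Z := rts (fam₁ S)
  obtain ⟨y', hB, hA⟩ := exists_between_finsets ((Z.filter (· < y)).image e)
    ((Z.filter fun z => ¬z < y).image e) (by
      intro b hb a ha
      obtain ⟨zb, hzb, rfl⟩ := Finset.mem_image.mp hb
      obtain ⟨za, hza, rfl⟩ := Finset.mem_image.mp ha
      rw [Finset.mem_filter] at hzb hza
      exact (h.lt_iff_lt hzb.1 hza.1).mpr (lt_of_lt_of_le hzb.2 (not_lt.mp hza.2)))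
  refine ⟨y', fun hy' => ?_, fun z hz => ?_⟩
  · obtain ⟨z, hz, rfl⟩ := h.bijOn.surjOn hy'
    by_cases hzy : z < y
    · exact lt_irrefl _ (hB _ (Finset.mem_image_of_mem _ (Finset.mem_filter.mpr ⟨hz, hzy⟩)))
    · exact lt_irrefl _ (hA _ (Finset.mem_image_of_mem _ (Finset.mem_filter.mpr ⟨hz, hzy⟩)))
  · constructor
    · intro hzy
      exact hB _ (Finset.mem_image_of_mem _ (Finset.mem_filter.mpr ⟨hz, hzy⟩))
    · intro hlt
      by_contra hzy
      exact lt_asymm hlt (hA _ (Finset.mem_image_of_mem _ (Finset.mem_filter.mpr ⟨hz, hzy⟩)))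

/-- Every gap of the second family corresponds to a gap of the first. [folklore] -/
theorem exists_corr' (h : IsCorrespondence S e) (y' : ℝ) :
    ∃ y, y ∉ rts (fam₁ S) ∧ Corr e (rts (fam₁ S)) y y' := by
  classical
  set Z := rts (fam₁ S)
  obtain ⟨y, hB, hA⟩ := exists_between_finsets (Z.filter fun z => e z < y')
    (Z.filter fun z => ¬e z < y') (by
      intro b hb a ha
      rw [Finset.mem_filter] at hb ha
      by_contra hba
      exact ha.2 (lt_of_le_of_lt ((h.le_iff_le ha.1 hb.1).mpr (not_lt.mp hba)) hb.2))
  refine ⟨y, fun hy => ?_, fun z hz => ?_⟩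
  · by_cases hzy : e y < y'
    · exact lt_irrefl _ (hB _ (Finset.mem_filter.mpr ⟨hy, hzy⟩))
    · exact lt_irrefl _ (hA _ (Finset.mem_filter.mpr ⟨hy, hzy⟩))
  · constructor
    · intro hzy
      by_contra hzy'
      exact lt_asymm hzy (hA _ (Finset.mem_filter.mpr ⟨hz, hzy'⟩))
    · intro hzy'
      exact hB _ (Finset.mem_filter.mpr ⟨hz, hzy'⟩)

/-- Under a correspondence, the roots below corresponding points correspond. [folklore] -/
theorem below_eq_image (h : IsCorrespondence S e) {y y' : ℝ}
    (hc : Corr e (rts (fam₁ S)) y y') :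
    below (fam₂ S) y' = (below (fam₁ S) y).image e := by
  ext z'
  simp only [mem_below, Finset.mem_image]
  constructor
  · rintro ⟨hz', hlt⟩
    obtain ⟨z, hz, rfl⟩ := h.bijOn.surjOn hz'
    exact ⟨z, ⟨hz, (hc z hz).mpr hlt⟩, rfl⟩
  · rintro ⟨z, ⟨hz, hlt⟩, rfl⟩
    exact ⟨h.mem_of_mem hz, (hc z hz).mp hlt⟩

/-- Under a correspondence, the roots above corresponding non-roots correspond. [folklore] -/
theorem above_eq_image (h : IsCorrespondence S e) {y y' : ℝ} (hy : y ∉ rts (fam₁ S))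
    (hy' : y' ∉ rts (fam₂ S)) (hc : Corr e (rts (fam₁ S)) y y') :
    above (fam₂ S) y' = (above (fam₁ S) y).image e := by
  ext z'
  simp only [mem_above, Finset.mem_image]
  constructor
  · rintro ⟨hz', hlt⟩
    obtain ⟨z, hz, rfl⟩ := h.bijOn.surjOn hz'
    refine ⟨z, ⟨hz, ?_⟩, rfl⟩
    have h1 : ¬z < y := fun hzy => lt_asymm hlt ((hc z hz).mp hzy)
    exact lt_of_le_of_ne (not_lt.mp h1) fun h' => hy (h' ▸ hz)
  · rintro ⟨z, ⟨hz, hlt⟩, rfl⟩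
    refine ⟨h.mem_of_mem hz, ?_⟩
    have h1 : ¬e z < y' := fun h' => lt_asymm hlt ((hc z hz).mpr h')
    exact lt_of_le_of_ne (not_lt.mp h1) fun h' => hy' (h' ▸ h.mem_of_mem hz)

/-- A correspondence commutes with `max'` on sets of roots. [folklore] -/
theorem image_max' (h : IsCorrespondence S e) {B : Finset ℝ} (hB : B ⊆ rts (fam₁ S))
    (hne : B.Nonempty) (hne' : (B.image e).Nonempty) :
    (B.image e).max' hne' = e (B.max' hne) := by
  refine le_antisymm ?_ (Finset.le_max' _ _ (Finset.mem_image_of_mem _ (Finset.max'_mem _ _)))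
  refine Finset.max'_le _ _ _ fun x hx => ?_
  obtain ⟨z, hz, rfl⟩ := Finset.mem_image.mp hx
  exact (h.le_iff_le (hB hz) (hB (Finset.max'_mem _ _))).mpr (Finset.le_max' _ _ hz)

/-- A correspondence commutes with `min'` on sets of roots. [folklore] -/
theorem image_min' (h : IsCorrespondence S e) {B : Finset ℝ} (hB : B ⊆ rts (fam₁ S))
    (hne : B.Nonempty) (hne' : (B.image e).Nonempty) :
    (B.image e).min' hne' = e (B.min' hne) := by
  refine le_antisymm (Finset.min'_le _ _ (Finset.mem_image_of_mem _ (Finset.min'_mem _ _))) ?_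
  refine Finset.le_min' _ _ _ fun x hx => ?_
  obtain ⟨z, hz, rfl⟩ := Finset.mem_image.mp hx
  exact (h.le_iff_le (hB (Finset.min'_mem _ _)) (hB hz)).mpr (Finset.min'_le _ _ hz)

/-- **Transfer of endpoint signs (C3).** For polynomials `p`, `q` of the same degree, the same
sign of leading coefficient and the same signs at corresponding roots, the left endpoint signs of
corresponding gaps agree. [folklore] -/
theorem sigL_eq (h : IsCorrespondence S e) {p q : ℝ[X]} (hpq : p.natDegree = q.natDegree)
    (hlc : SignType.sign p.leadingCoeff = SignType.sign q.leadingCoeff)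
    (hroots : ∀ z ∈ rts (fam₁ S), SignType.sign (p.eval z) = SignType.sign (q.eval (e z)))
    {y y' : ℝ} (hc : Corr e (rts (fam₁ S)) y y') :
    sigL (fam₂ S) q y' = sigL (fam₁ S) p y := by
  have hbe := h.below_eq_image hc
  have hsub : below (fam₁ S) y ⊆ rts (fam₁ S) := Finset.filter_subset _ _
  unfold sigL
  by_cases hne : (below (fam₁ S) y).Nonempty
  · have hne' : (below (fam₂ S) y').Nonempty := by
      rw [hbe]; exact hne.image _
    rw [dif_pos hne', dif_pos hne]
    have : (below (fam₂ S) y').max' hne' = e ((below (fam₁ S) y).max' hne) := by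
      have hne'' : ((below (fam₁ S) y).image e).Nonempty := hne.image _
      rw [← h.image_max' hsub hne hne'']
      congr 1
    rw [this, hroots _ (hsub (Finset.max'_mem _ _))]
  · have hne' : ¬(below (fam₂ S) y').Nonempty := by
      rw [hbe, Finset.image_nonempty]; exact hne
    rw [dif_neg hne', dif_neg hne]
    simp only [signBot, hpq, hlc]

/-- **Transfer of endpoint signs (C3)**, right endpoints. [folklore] -/
theorem sigR_eq (h : IsCorrespondence S e) {p q : ℝ[X]}
    (hlc : SignType.sign p.leadingCoeff = SignType.sign q.leadingCoeff)
    (hroots : ∀ z ∈ rts (fam₁ S), SignType.sign (p.eval z) = SignType.sign (q.eval (e z)))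
    {y y' : ℝ} (hy : y ∉ rts (fam₁ S)) (hy' : y' ∉ rts (fam₂ S))
    (hc : Corr e (rts (fam₁ S)) y y') :
    sigR (fam₂ S) q y' = sigR (fam₁ S) p y := by
  have hae := h.above_eq_image hy hy' hc
  have hsub : above (fam₁ S) y ⊆ rts (fam₁ S) := Finset.filter_subset _ _
  unfold sigR
  by_cases hne : (above (fam₁ S) y).Nonempty
  · have hne' : (above (fam₂ S) y').Nonempty := by
      rw [hae]; exact hne.image _
    rw [dif_pos hne', dif_pos hne]
    have : (above (fam₂ S) y').min' hne' = e ((above (fam₁ S) y).min' hne) := by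
      have hne'' : ((above (fam₁ S) y).image e).Nonempty := hne.image _
      rw [← h.image_min' hsub hne hne'']
      congr 1
    rw [this, hroots _ (hsub (Finset.min'_mem _ _))]
  · have hne' : ¬(above (fam₂ S) y').Nonempty := by
      rw [hae, Finset.image_nonempty]; exact hne
    rw [dif_neg hne', dif_neg hne]
    simp only [signTop, hlc]

/-- **Extension theorem** (the Cohen–Hörmander step). Let `e` be a correspondence for `S`, and
let `p`, `q` be polynomials of the same positive degree with leading coefficients of the same
sign, whose derivatives belong to the respective families, and whose signs at corresponding roots
of the families agree. Then the families extended by the pair `(p, q)` still have isomorphic sign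
diagrams: on each gap `p` (resp. `q`) is strictly monotone, so its roots there and its signs
around them are dictated by the endpoint signs of the gap, which correspond.
[cite: BasuPollackRoy2006, Lemma 5.33 (Thom's lemma), proof] -/
theorem isoDiag_insert (h : IsCorrespondence S e) {p q : ℝ[X]} (hp : 0 < p.natDegree)
    (hpq : p.natDegree = q.natDegree)
    (hlc : SignType.sign p.leadingCoeff = SignType.sign q.leadingCoeff)
    (hdp : p.derivative ∈ fam₁ S) (hdq : q.derivative ∈ fam₂ S)
    (hroots : ∀ z ∈ rts (fam₁ S), SignType.sign (p.eval z) = SignType.sign (q.eval (e z))) :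
    IsoDiag (insert (p, q) S) := by
  classical
  have hq : 0 < q.natDegree := hpq ▸ hp
  have hp0 : p ≠ 0 := ne_zero_of_natDegree_gt hp
  have hq0 : q ≠ 0 := ne_zero_of_natDegree_gt hq
  have hdp0 : p.derivative ≠ 0 := derivative_ne_zero.mpr hp.ne'
  have hdq0 : q.derivative ≠ 0 := derivative_ne_zero.mpr hq.ne'
  have hdZ : ∀ r, p.derivative.eval r = 0 → r ∈ rts (fam₁ S) := fun r hr =>
    mem_rts.mpr ⟨_, hdp, hdp0, hr⟩
  have hdZ' : ∀ r, q.derivative.eval r = 0 → r ∈ rts (fam₂ S) := fun r hr =>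
    mem_rts.mpr ⟨_, hdq, hdq0, hr⟩
  -- the new root sets
  have hZ1 : ∀ z, z ∈ rts (fam₁ (insert (p, q) S)) ↔ p.eval z = 0 ∨ z ∈ rts (fam₁ S) := by
    intro z; rw [fam₁_insert, mem_rts_insert]; simp [hp0]
  have hZ2 : ∀ z, z ∈ rts (fam₂ (insert (p, q) S)) ↔ q.eval z = 0 ∨ z ∈ rts (fam₂ S) := by
    intro z; rw [fam₂_insert, mem_rts_insert]; simp [hq0]
  -- transfer of endpoint signs
  have hL : ∀ {y y'}, Corr e (rts (fam₁ S)) y y' → sigL (fam₂ S) q y' = sigL (fam₁ S) p y :=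
    fun hc => h.sigL_eq hpq hlc hroots hc
  have hR : ∀ {y y'}, y ∉ rts (fam₁ S) → y' ∉ rts (fam₂ S) → Corr e (rts (fam₁ S)) y y' →
      sigR (fam₂ S) q y' = sigR (fam₁ S) p y :=
    fun hy hy' hc => h.sigR_eq hlc hroots hy hy' hc
  -- new roots of `p` correspond to new roots of `q`
  have hnew : ∀ y, y ∉ rts (fam₁ S) → p.eval y = 0 →
      ∃ r', r' ∉ rts (fam₂ S) ∧ Corr e (rts (fam₁ S)) y r' ∧ q.eval r' = 0 := by
    intro y hy hy0
    obtain ⟨y', hy', hc⟩ := h.exists_corr y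
    have h1 : sigL (fam₁ S) p y = -sigR (fam₁ S) p y ∧ sigL (fam₁ S) p y ≠ 0 :=
      (exists_root_gap_iff hp hdZ hy).mp ⟨y, hy, rfl, hy0⟩
    rw [← hL hc, ← hR hy hy' hc] at h1
    obtain ⟨r', hr', hbr, hr0⟩ := (exists_root_gap_iff hq hdZ' hy').mpr h1
    refine ⟨r', hr', fun z hz => ?_, hr0⟩
    rw [hc z hz]
    exact (below_eq_below_iff.mp hbr (e z) (h.mem_of_mem hz)).symm
  have hnew' : ∀ y', y' ∉ rts (fam₂ S) → q.eval y' = 0 →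
      ∃ r, r ∉ rts (fam₁ S) ∧ Corr e (rts (fam₁ S)) r y' ∧ p.eval r = 0 := by
    intro y' hy' hy0'
    obtain ⟨y, hy, hc⟩ := h.exists_corr' y'
    have h1 : sigL (fam₂ S) q y' = -sigR (fam₂ S) q y' ∧ sigL (fam₂ S) q y' ≠ 0 :=
      (exists_root_gap_iff hq hdZ' hy').mp ⟨y', hy', rfl, hy0'⟩
    rw [hL hc, hR hy hy' hc] at h1
    obtain ⟨r, hr, hbr, hr0⟩ := (exists_root_gap_iff hp hdZ hy).mpr h1
    refine ⟨r, hr, fun z hz => ?_, hr0⟩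
    rw [← hc z hz]
    exact below_eq_below_iff.mp hbr z hz
  -- at most one new root per gap
  have huniq : ∀ y' r₁ r₂, r₁ ∉ rts (fam₁ S) → r₂ ∉ rts (fam₁ S) →
      Corr e (rts (fam₁ S)) r₁ y' → Corr e (rts (fam₁ S)) r₂ y' →
      p.eval r₁ = 0 → p.eval r₂ = 0 → r₁ = r₂ := by
    intro y' r₁ r₂ h₁ h₂ hc₁ hc₂ hp₁ hp₂
    refine root_gap_unique hp hdZ h₁ h₂ (below_eq_below_iff.mpr fun z hz => ?_) hp₁ hp₂
    rw [hc₁ z hz, hc₂ z hz]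
  have huniq' : ∀ y r₁ r₂, r₁ ∉ rts (fam₂ S) → r₂ ∉ rts (fam₂ S) →
      Corr e (rts (fam₁ S)) y r₁ → Corr e (rts (fam₁ S)) y r₂ →
      q.eval r₁ = 0 → q.eval r₂ = 0 → r₁ = r₂ := by
    intro y r₁ r₂ h₁ h₂ hc₁ hc₂ hq₁ hq₂
    refine root_gap_unique hq hdZ' h₁ h₂ (below_eq_below_iff.mpr fun z' hz' => ?_) hq₁ hq₂
    obtain ⟨z, hz, rfl⟩ := h.bijOn.surjOn hz'
    rw [← hc₁ z hz, ← hc₂ z hz]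
  -- the extended map
  obtain ⟨e', he'_old, he'_new⟩ : ∃ e' : ℝ → ℝ, (∀ z ∈ rts (fam₁ S), e' z = e z) ∧
      (∀ y, y ∉ rts (fam₁ S) → p.eval y = 0 →
        e' y ∉ rts (fam₂ S) ∧ Corr e (rts (fam₁ S)) y (e' y) ∧ q.eval (e' y) = 0) := by
    refine ⟨fun y => if y ∈ rts (fam₁ S) then e y else
      if hex : ∃ r', r' ∉ rts (fam₂ S) ∧ Corr e (rts (fam₁ S)) y r' ∧ q.eval r' = 0
        then hex.choose else e y, fun z hz => by simp [hz], fun y hy hy0 => ?_⟩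
    have hex := hnew y hy hy0
    simp only [hy, if_false, dif_pos hex]
    exact hex.choose_spec
  -- basic order facts about `e'`
  have hmono₁ : ∀ a b, a ∈ rts (fam₁ S) → b ∉ rts (fam₁ S) → p.eval b = 0 → a < b →
      e' a < e' b := by
    intro a b ha hb hb0 hab
    rw [he'_old a ha]
    exact ((he'_new b hb hb0).2.1 a ha).mp hab
  have hmono₂ : ∀ a b, a ∉ rts (fam₁ S) → p.eval a = 0 → b ∈ rts (fam₁ S) → a < b →
      e' a < e' b := by
    intro a b ha ha0 hb hab
    rw [he'_old b hb]
    obtain ⟨haZ', hca, -⟩ := he'_new a ha ha0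
    have h1 : ¬e b < e' a := fun h' => lt_asymm hab ((hca b hb).mpr h')
    exact lt_of_le_of_ne (not_lt.mp h1) fun h' => haZ' (h' ▸ h.mem_of_mem hb)
  have hsm : StrictMonoOn e' (rts (fam₁ (insert (p, q) S)) : Set ℝ) := by
    intro a ha b hb hab
    rw [Finset.mem_coe, hZ1] at ha hb
    by_cases haZ : a ∈ rts (fam₁ S) <;> by_cases hbZ : b ∈ rts (fam₁ S)
    · rw [he'_old a haZ, he'_old b hbZ]; exact (h.lt_iff_lt haZ hbZ).mpr hab
    · exact hmono₁ a b haZ hbZ (hb.resolve_right hbZ) hab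
    · exact hmono₂ a b haZ (ha.resolve_right haZ) hbZ hab
    · have ha0 := ha.resolve_right haZ
      have hb0 := hb.resolve_right hbZ
      by_cases hmid : ∃ z ∈ rts (fam₁ S), a < z ∧ z < b
      · obtain ⟨z, hz, haz, hzb⟩ := hmid
        exact (hmono₂ a z haZ ha0 hz haz).trans (hmono₁ z b hz hbZ hb0 hzb)
      · push Not at hmid
        exfalso
        have hbel : below (fam₁ S) b = below (fam₁ S) a := by
          refine below_eq_below_iff.mpr fun z hz => ⟨fun hzb => ?_, fun hza => hza.trans hab⟩
          by_contra hza
          have haz : a < z := lt_of_le_of_ne (not_lt.mp hza) (fun h' => haZ (h' ▸ hz))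
          exact absurd hzb (not_lt.mpr (hmid z hz haz))
        exact absurd (root_gap_unique hp hdZ haZ hbZ hbel ha0 hb0) hab.ne
  refine ⟨e', ⟨fun z hz => ?_, hsm.injOn, fun z' hz' => ?_⟩, hsm, ?_, ?_⟩
  · -- maps to
    rw [Finset.mem_coe] at hz ⊢
    rw [hZ2]
    by_cases hzZ : z ∈ rts (fam₁ S)
    · exact Or.inr (he'_old z hzZ ▸ h.mem_of_mem hzZ)
    · have hz0 : p.eval z = 0 := ((hZ1 z).mp hz).resolve_right hzZ
      exact Or.inl (he'_new z hzZ hz0).2.2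
  · -- surjective
    rw [Finset.mem_coe, hZ2] at hz'
    by_cases hzZ' : z' ∈ rts (fam₂ S)
    · obtain ⟨z, hz, rfl⟩ := h.bijOn.surjOn hzZ'
      exact ⟨z, by rw [Finset.mem_coe, hZ1]; exact Or.inr hz, he'_old z hz⟩
    · have hz0' : q.eval z' = 0 := hz'.resolve_right hzZ'
      obtain ⟨r, hr, hcr, hr0⟩ := hnew' z' hzZ' hz0'
      refine ⟨r, by rw [Finset.mem_coe, hZ1]; exact Or.inl hr0, ?_⟩
      obtain ⟨hrZ', hcr', hr0'⟩ := he'_new r hr hr0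
      exact huniq' r _ _ hrZ' hzZ' hcr' hcr hr0' hz0'
  · -- signs at roots
    intro pr hpr z hz
    rw [hZ1] at hz
    rw [Finset.mem_insert] at hpr
    by_cases hzZ : z ∈ rts (fam₁ S)
    · rw [he'_old z hzZ]
      rcases hpr with rfl | hpr
      · exact hroots z hzZ
      · exact h.sign_root pr hpr z hzZ
    · have hz0 : p.eval z = 0 := hz.resolve_right hzZ
      obtain ⟨hzZ', hcz, hz0'⟩ := he'_new z hzZ hz0
      rcases hpr with rfl | hpr
      · simp only [hz0, hz0', sign_zero]
      · exact h.sign_gap pr hpr z (e' z) hzZ hzZ' hcz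
  · -- signs on gaps
    intro pr hpr y y' hy hy' hc'
    rw [hZ1, not_or] at hy
    rw [hZ2, not_or] at hy'
    obtain ⟨hyp, hyZ⟩ := hy
    obtain ⟨hyq, hyZ'⟩ := hy'
    have hc : Corr e (rts (fam₁ S)) y y' := fun z hz => by
      rw [← he'_old z hz]; exact hc' z ((hZ1 z).mpr (Or.inr hz))
    rw [Finset.mem_insert] at hpr
    rcases hpr with rfl | hpr
    swap
    · exact h.sign_gap pr hpr y y' hyZ hyZ' hc
    · dsimp only
      by_cases hex : ∃ r, r ∉ rts (fam₁ S) ∧ below (fam₁ S) r = below (fam₁ S) y ∧ p.eval r = 0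
      · obtain ⟨r, hr, hbr, hr0⟩ := hex
        rw [sign_gap_of_root hp hdZ hyZ hyp hr hbr hr0]
        obtain ⟨hrZ', hcr, hr0'⟩ := he'_new r hr hr0
        have hbr' : below (fam₂ S) (e' r) = below (fam₂ S) y' := by
          refine below_eq_below_iff.mpr fun z' hz' => ?_
          obtain ⟨z, hz, rfl⟩ := h.bijOn.surjOn hz'
          rw [← hcr z hz, ← hc z hz]
          exact below_eq_below_iff.mp hbr z hz
        rw [sign_gap_of_root hq hdZ' hyZ' hyq hrZ' hbr' hr0', hL hc, hR hyZ hyZ' hc]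
        have h1 := hc' r ((hZ1 r).mpr (Or.inl hr0))
        have hyr : y ≠ r := fun h' => hyp (h' ▸ hr0)
        have hyr' : y' ≠ e' r := fun h' => hyq (h' ▸ hr0')
        have hiff : y < r ↔ y' < e' r := by
          constructor
          · intro hlt
            by_contra hge
            exact lt_asymm hlt (h1.mpr (lt_of_le_of_ne (not_lt.mp hge) hyr'.symm))
          · intro hlt
            by_contra hge
            exact lt_asymm hlt (h1.mp (lt_of_le_of_ne (not_lt.mp hge) hyr.symm))
        simp only [hiff]
      · push Not at hex
        rw [sign_gap_of_no_root hp hdZ hyZ hex]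
        have hex' : ∀ r', r' ∉ rts (fam₂ S) → below (fam₂ S) r' = below (fam₂ S) y' →
            q.eval r' ≠ 0 := by
          intro r' hr' hbr' hq0'
          obtain ⟨r, hr, hcr, hr0⟩ := hnew' r' hr' hq0'
          refine hex r hr ?_ hr0
          refine below_eq_below_iff.mpr fun z hz => ?_
          rw [hcr z hz, hc z hz]
          exact below_eq_below_iff.mp hbr' (e z) (h.mem_of_mem hz)
        rw [sign_gap_of_no_root hq hdZ' hyZ' hex', hL hc, hR hyZ hyZ' hc]

/-- **Transfer of realized sign conditions.** Under a correspondence, every simultaneous sign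
condition realized by the first components at some point is realized by the second components at
some (corresponding) point. [folklore] -/
theorem exists_sign_eq (h : IsCorrespondence S e) (y : ℝ) :
    ∃ y', ∀ pr ∈ S, SignType.sign (pr.1.eval y) = SignType.sign (pr.2.eval y') := by
  by_cases hy : y ∈ rts (fam₁ S)
  · exact ⟨e y, fun pr hpr => h.sign_root pr hpr y hy⟩
  · obtain ⟨y', hy', hc⟩ := h.exists_corr y
    exact ⟨y', fun pr hpr => h.sign_gap pr hpr y y' hy hy' hc⟩

end IsCorrespondence

/-- **Base case.** A family of pairs of constant polynomials with matching signs has isomorphic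
sign diagrams (both root sets are empty). [folklore] -/
theorem isoDiag_of_natDegree_eq_zero {S : Finset (ℝ[X] × ℝ[X])}
    (h : ∀ pr ∈ S, pr.1.natDegree = 0 ∧ pr.2.natDegree = 0 ∧
      SignType.sign (pr.1.coeff 0) = SignType.sign (pr.2.coeff 0)) :
    IsoDiag S := by
  have hc : ∀ pr ∈ S, ∀ y y', SignType.sign (pr.1.eval y) = SignType.sign (pr.2.eval y') := by
    intro pr hpr y y'
    obtain ⟨h1, h2, h3⟩ := h pr hpr
    rw [eq_C_of_natDegree_eq_zero h1, eq_C_of_natDegree_eq_zero h2, eval_C, eval_C, h3]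
  have hZ1 : rts (fam₁ S) = ∅ := by
    refine Finset.eq_empty_of_forall_notMem fun z hz => ?_
    obtain ⟨f, hf, hf0, hfz⟩ := mem_rts.mp hz
    obtain ⟨pr, hpr, rfl⟩ := Finset.mem_image.mp hf
    obtain ⟨h1, -, -⟩ := h pr hpr
    rw [eq_C_of_natDegree_eq_zero h1, eval_C] at hfz
    exact hf0 (by rw [eq_C_of_natDegree_eq_zero h1, hfz, C_0])
  have hZ2 : rts (fam₂ S) = ∅ := by
    refine Finset.eq_empty_of_forall_notMem fun z hz => ?_
    obtain ⟨f, hf, hf0, hfz⟩ := mem_rts.mp hz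
    obtain ⟨pr, hpr, rfl⟩ := Finset.mem_image.mp hf
    obtain ⟨-, h2, -⟩ := h pr hpr
    rw [eq_C_of_natDegree_eq_zero h2, eval_C] at hfz
    exact hf0 (by rw [eq_C_of_natDegree_eq_zero h2, hfz, C_0])
  refine ⟨id, ⟨fun z hz => ?_, Set.injOn_id _, fun z hz => ?_⟩, fun a _ b _ hab => hab,
    fun pr hpr z _ => hc pr hpr z z, fun pr hpr y y' _ _ _ => hc pr hpr y y'⟩
  · simp [hZ1] at hz
  · simp [hZ2] at hz

/-- Realized sign conditions transfer along isomorphic sign diagrams. [folklore] -/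
theorem IsoDiag.exists_sign_eq {S : Finset (ℝ[X] × ℝ[X])} (h : IsoDiag S) (y : ℝ) :
    ∃ y', ∀ pr ∈ S, SignType.sign (pr.1.eval y) = SignType.sign (pr.2.eval y') := by
  obtain ⟨e, he⟩ := h
  exact he.exists_sign_eq y

end Pairs

/-! ## Parametric part: stable families over a coefficient ring -/

section CommRing

variable {A : Type*} [CommRing A]

/-! ### Signed pseudo-remainders -/

/-- A **scaled pseudo-remainder** of `p` by `q`: a polynomial of degree `< deg q` which, at every
common root `z` of (a specialization of) `q`, takes the value `lc(q) ^ deg p * p(z)`. It is obtained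
by dividing the root-scaled polynomial `scaleRoots p (lc q)` by the monic integral normalization
of `q` and scaling the variable back. [Basu–Pollack–Roy 2006, §1.3 (signed pseudo-remainder),
variant] [cite: BasuPollackRoy2006, §1.3, Notation 1.16 (PRem, Tru), pp. 21–22] -/
def sprem (p q : A[X]) : A[X] :=
  (scaleRoots p q.leadingCoeff %ₘ integralNormalization q).comp (C q.leadingCoeff * X)

/-- The scaled pseudo-remainder by `q` has degree `< deg q` (for `deg q > 0`).
[cite: BasuPollackRoy2006, §1.3, Notation 1.16 (PRem, Tru), pp. 21–22] -/
theorem natDegree_sprem_lt {p q : A[X]} (hq : 0 < q.natDegree) :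
    (sprem p q).natDegree < q.natDegree := by
  have hq0 : q ≠ 0 := ne_zero_of_natDegree_gt hq
  haveI : Nontrivial A := Polynomial.nontrivial_iff.mp (nontrivial_of_ne q 0 hq0)
  have hmonic : (integralNormalization q).Monic := monic_integralNormalization hq0
  have hne : integralNormalization q ≠ 1 := by
    intro h1
    have := congrArg natDegree h1
    rw [natDegree_integralNormalization, natDegree_one] at this
    exact hq.ne' this
  have h1 := natDegree_modByMonic_lt (scaleRoots p q.leadingCoeff) hmonic hne
  rw [natDegree_integralNormalization] at h1
  refine lt_of_le_of_lt (natDegree_comp_le.trans ?_) h1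
  calc (scaleRoots p q.leadingCoeff %ₘ integralNormalization q).natDegree *
        (C q.leadingCoeff * X).natDegree
        ≤ (scaleRoots p q.leadingCoeff %ₘ integralNormalization q).natDegree * 1 :=
          Nat.mul_le_mul_left _ ((natDegree_C_mul_le _ _).trans natDegree_X_le)
    _ = _ := mul_one _

/-- **Pseudo-remainder identity at roots.** If `z` is a root of the specialization of `q` under a
ring homomorphism `φ` into a commutative ring, then the specialization of `sprem p q` takes at `z`
the value `φ(lc q) ^ deg p * p(z)`.
[cite: BasuPollackRoy2006, §1.3, Notation 1.16 (PRem, Tru), pp. 21–22] -/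
theorem eval₂_sprem {S : Type*} [CommRing S] (φ : A →+* S) {p q : A[X]} (hq : 0 < q.natDegree)
    {z : S} (hz : q.eval₂ φ z = 0) :
    (sprem p q).eval₂ φ z = φ q.leadingCoeff ^ p.natDegree * p.eval₂ φ z := by
  have hdiv := modByMonic_add_div (scaleRoots p q.leadingCoeff) (integralNormalization q)
  have h1 : (scaleRoots p q.leadingCoeff %ₘ integralNormalization q).eval₂ φ (φ q.leadingCoeff * z)
      = φ q.leadingCoeff ^ p.natDegree * p.eval₂ φ z := by
    have h2 := congrArg (eval₂ φ (φ q.leadingCoeff * z)) hdiv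
    rw [eval₂_add, eval₂_mul, integralNormalization_eval₂_leadingCoeff_mul hq, hz, mul_zero,
      zero_mul, add_zero, scaleRoots_eval₂_mul] at h2
    exact h2
  rw [sprem, eval₂_comp, eval₂_mul, eval₂_C, eval₂_X, h1]

/-! ### Stable families -/

/-- A finite family of polynomials over `A` is **stable** if it is closed under derivative,
under erasing the leading term, and under scaled pseudo-remainders `sprem f g` by members `g` of
positive degree at most `deg f` — the closure properties of the set of nodes of the trees
`TRems` of Basu–Pollack–Roy together with closure under derivative (the hypothesis of Thom's
lemma); cf. the families "stable under derivation and division" of Cohen–Hörmander elimination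
(Bochnak–Coste–Roy 1998, §1.4).
[cite: BasuPollackRoy2006, §1.3, Notation 1.16 (PRem, Tru), pp. 21–22] -/
def IsStable (P : Finset A[X]) : Prop :=
  ∀ f ∈ P, derivative f ∈ P ∧ eraseLead f ∈ P ∧
    ∀ g ∈ P, 0 < g.natDegree → g.natDegree ≤ f.natDegree → sprem f g ∈ P

namespace IsStable

variable {P : Finset A[X]}

/-- Stable families are closed under derivative.
[cite: BasuPollackRoy2006, §1.3, Notation 1.16 (PRem, Tru), pp. 21–22] -/
theorem derivative_mem (hP : IsStable P) {f : A[X]} (hf : f ∈ P) : derivative f ∈ P :=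
  (hP f hf).1

/-- Stable families are closed under erasing the leading term (truncation).
[cite: BasuPollackRoy2006, §1.3, Notation 1.16 (PRem, Tru), pp. 21–22] -/
theorem eraseLead_mem (hP : IsStable P) {f : A[X]} (hf : f ∈ P) : eraseLead f ∈ P :=
  (hP f hf).2.1

/-- Stable families are closed under scaled pseudo-remainders.
[cite: BasuPollackRoy2006, §1.3, Notation 1.16 (PRem, Tru), pp. 21–22] -/
theorem sprem_mem (hP : IsStable P) {f g : A[X]} (hf : f ∈ P) (hg : g ∈ P)
    (hg0 : 0 < g.natDegree) (hfg : g.natDegree ≤ f.natDegree) : sprem f g ∈ P :=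
  (hP f hf).2.2 g hg hg0 hfg

/-- Stable families are closed under iterated derivatives.
[cite: BasuPollackRoy2006, §1.3, Notation 1.16 (PRem, Tru), pp. 21–22] -/
theorem iterate_derivative_mem (hP : IsStable P) {f : A[X]} (hf : f ∈ P) (k : ℕ) :
    derivative^[k] f ∈ P := by
  induction k with
  | zero => exact hf
  | succ k ih => rw [Function.iterate_succ_apply']; exact hP.derivative_mem ih

/-- Removing a member of maximal (positive) degree from a stable family leaves a stable family.
[cite: BasuPollackRoy2006, §1.3, Notation 1.16 (PRem, Tru), pp. 21–22] -/
theorem erase [DecidableEq A] (hP : IsStable P) {p : A[X]} (hd : 0 < p.natDegree)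
    (hmax : ∀ f ∈ P, f.natDegree ≤ p.natDegree) : IsStable (P.erase p) := by
  have hp0 : p ≠ 0 := ne_zero_of_natDegree_gt hd
  intro f hf
  obtain ⟨hfp, hfP⟩ := Finset.mem_erase.mp hf
  refine ⟨Finset.mem_erase.mpr ⟨fun h => ?_, hP.derivative_mem hfP⟩,
    Finset.mem_erase.mpr ⟨fun h => ?_, hP.eraseLead_mem hfP⟩, fun g hg hg0 hgf => ?_⟩
  · -- derivative f ≠ p
    by_cases hf0 : f.natDegree = 0
    · rw [derivative_of_natDegree_zero hf0] at h
      exact hp0 h.symm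
    · have := natDegree_derivative_lt hf0
      rw [h] at this
      exact absurd (hmax f hfP) (not_le.mpr this)
  · rcases eraseLead_natDegree_lt_or_eraseLead_eq_zero f with hlt | h0
    · rw [h] at hlt
      exact absurd (hmax f hfP) (not_le.mpr hlt)
    · rw [h0] at h
      exact hp0 h.symm
  · obtain ⟨-, hgP⟩ := Finset.mem_erase.mp hg
    refine Finset.mem_erase.mpr ⟨fun h => ?_, hP.sprem_mem hfP hgP hg0 hgf⟩
    have := natDegree_sprem_lt (p := f) hg0
    rw [h] at this
    exact absurd (hmax g hgP) (not_le.mpr this)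

end IsStable

/-! ### Existence of finite stable families -/

section Closure

variable (S : Finset A[X])

/-- The inductive closure of a family under the three operations of `IsStable`.
[cite: BasuPollackRoy2006, §1.3, Notation 1.16 (PRem, Tru), pp. 21–22] -/
inductive InClosure : A[X] → Prop
  | base {f : A[X]} (hf : f ∈ S) : InClosure f
  | zero : InClosure 0
  | deriv {f : A[X]} (hf : InClosure f) : InClosure (derivative f)
  | erase {f : A[X]} (hf : InClosure f) : InClosure (eraseLead f)
  | rem {f g : A[X]} (hf : InClosure f) (hg : InClosure g) (hg0 : 0 < g.natDegree)
      (hfg : g.natDegree ≤ f.natDegree) : InClosure (sprem f g)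

variable {S}

/-- The closure operations do not increase the degree.
[cite: BasuPollackRoy2006, §1.3, Notation 1.16 (PRem, Tru), pp. 21–22] -/
theorem InClosure.natDegree_le {D : ℕ} (hD : ∀ f ∈ S, f.natDegree ≤ D) {f : A[X]}
    (hf : InClosure S f) : f.natDegree ≤ D := by
  induction hf with
  | base hf => exact hD _ hf
  | zero => simp
  | deriv _ ih => exact (natDegree_derivative_le _).trans ((Nat.sub_le _ _).trans ih)
  | erase _ ih => exact (eraseLead_natDegree_le _).trans ((Nat.sub_le _ _).trans ih)
  | rem _ _ hg0 _ _ ihg => exact (natDegree_sprem_lt hg0).le.trans ihg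

variable [DecidableEq A] (S)

/-- One closure step. [cite: BasuPollackRoy2006, §1.3, Notation 1.16 (PRem, Tru), pp. 21–22] -/
def closureStep (T : Finset A[X]) : Finset A[X] :=
  T ∪ T.image derivative ∪ T.image eraseLead ∪
    ((T ×ˢ T).filter fun fg => 0 < fg.2.natDegree ∧ fg.2.natDegree ≤ fg.1.natDegree).image
      fun fg => sprem fg.1 fg.2

/-- Iterated closure steps, starting from `S ∪ {0}`.
[cite: BasuPollackRoy2006, §1.3, Notation 1.16 (PRem, Tru), pp. 21–22] -/
def closureIter : ℕ → Finset A[X]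
  | 0 => insert 0 S
  | j + 1 => closureStep (closureIter j)

variable {S}

/-- A closure step enlarges the family.
[cite: BasuPollackRoy2006, §1.3, Notation 1.16 (PRem, Tru), pp. 21–22] -/
theorem subset_closureStep (T : Finset A[X]) : T ⊆ closureStep T := fun _ hf =>
  Finset.mem_union.mpr (Or.inl (Finset.mem_union.mpr (Or.inl (Finset.mem_union.mpr (Or.inl hf)))))

/-- The iterated closure is monotone in the number of steps.
[cite: BasuPollackRoy2006, §1.3, Notation 1.16 (PRem, Tru), pp. 21–22] -/
theorem closureIter_mono {i j : ℕ} (h : i ≤ j) : closureIter S i ⊆ closureIter S j := by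
  induction h with
  | refl => exact Finset.Subset.refl _
  | step _ ih => exact Finset.Subset.trans ih (subset_closureStep _)

/-- A closure step adds derivatives.
[cite: BasuPollackRoy2006, §1.3, Notation 1.16 (PRem, Tru), pp. 21–22] -/
theorem derivative_mem_closureStep {T : Finset A[X]} {f : A[X]} (hf : f ∈ T) :
    derivative f ∈ closureStep T :=
  Finset.mem_union.mpr (Or.inl (Finset.mem_union.mpr (Or.inl (Finset.mem_union.mpr
    (Or.inr (Finset.mem_image_of_mem _ hf))))))

/-- A closure step adds truncations.
[cite: BasuPollackRoy2006, §1.3, Notation 1.16 (PRem, Tru), pp. 21–22] -/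
theorem eraseLead_mem_closureStep {T : Finset A[X]} {f : A[X]} (hf : f ∈ T) :
    eraseLead f ∈ closureStep T :=
  Finset.mem_union.mpr (Or.inl (Finset.mem_union.mpr (Or.inr (Finset.mem_image_of_mem _ hf))))

/-- A closure step adds scaled pseudo-remainders.
[cite: BasuPollackRoy2006, §1.3, Notation 1.16 (PRem, Tru), pp. 21–22] -/
theorem sprem_mem_closureStep {T : Finset A[X]} {f g : A[X]} (hf : f ∈ T) (hg : g ∈ T)
    (hg0 : 0 < g.natDegree) (hfg : g.natDegree ≤ f.natDegree) :
    sprem f g ∈ closureStep T := by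
  refine Finset.mem_union.mpr (Or.inr (Finset.mem_image.mpr ⟨(f, g), ?_, rfl⟩))
  exact Finset.mem_filter.mpr ⟨Finset.mem_product.mpr ⟨hf, hg⟩, hg0, hfg⟩

/-- Every element of the inductive closure appears at stage `D - deg` of the iteration.
[cite: BasuPollackRoy2006, §1.3, Notation 1.16 (PRem, Tru), pp. 21–22] -/
theorem InClosure.mem_closureIter {D : ℕ} (hD : ∀ f ∈ S, f.natDegree ≤ D) {f : A[X]}
    (hf : InClosure S f) : f ∈ closureIter S (D - f.natDegree) := by
  have h0 : ∀ j, (0 : A[X]) ∈ closureIter S j := fun j =>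
    closureIter_mono (Nat.zero_le j) (Finset.mem_insert_self _ _)
  induction hf with
  | base hf => exact closureIter_mono (Nat.zero_le _) (Finset.mem_insert_of_mem hf)
  | zero => exact h0 _
  | @deriv g hg ih =>
    by_cases hg0 : g.natDegree = 0
    · rw [derivative_of_natDegree_zero hg0]; exact h0 _
    · have hlt := natDegree_derivative_lt hg0
      have hle : g.natDegree ≤ D := hg.natDegree_le hD
      have hstep : derivative g ∈ closureIter S (D - g.natDegree + 1) :=
        derivative_mem_closureStep ih
      exact closureIter_mono (by omega) hstep
  | @erase g hg ih =>
    rcases eraseLead_natDegree_lt_or_eraseLead_eq_zero g with hlt | hz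
    · have hle : g.natDegree ≤ D := hg.natDegree_le hD
      have hstep : eraseLead g ∈ closureIter S (D - g.natDegree + 1) :=
        eraseLead_mem_closureStep ih
      exact closureIter_mono (by omega) hstep
    · rw [hz]; exact h0 _
  | @rem g k hg hk hk0 hkg ihg ihk =>
    have hlt := natDegree_sprem_lt (p := g) hk0
    have hleg : g.natDegree ≤ D := hg.natDegree_le hD
    have hg' : g ∈ closureIter S (D - k.natDegree) := closureIter_mono (by omega) ihg
    have hstep : sprem g k ∈ closureIter S (D - k.natDegree + 1) :=
      sprem_mem_closureStep hg' ihk hk0 hkg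
    exact closureIter_mono (by omega) hstep

/-- The iterated closure stays inside the inductive closure.
[cite: BasuPollackRoy2006, §1.3, Notation 1.16 (PRem, Tru), pp. 21–22] -/
theorem inClosure_of_mem_closureIter {j : ℕ} {f : A[X]} (hf : f ∈ closureIter S j) :
    InClosure S f := by
  induction j generalizing f with
  | zero =>
    rcases Finset.mem_insert.mp hf with rfl | hf
    · exact InClosure.zero
    · exact InClosure.base hf
  | succ j ih =>
    simp only [closureIter, closureStep, Finset.mem_union, Finset.mem_image,
      Finset.mem_filter, Finset.mem_product] at hf
    rcases hf with ((hf | ⟨g, hg, rfl⟩) | ⟨g, hg, rfl⟩) | ⟨⟨g, k⟩, ⟨⟨hg, hk⟩, hk0, hkg⟩, rfl⟩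
    · exact ih hf
    · exact (ih hg).deriv
    · exact (ih hg).erase
    · exact (ih hg).rem (ih hk) hk0 hkg

end Closure

/-- **Finite stable closures exist**: every finite family of polynomials is contained in a finite
stable family (the closure operations lower the degree, so the iteration from `S ∪ {0}` is
exhausted after `max deg` steps).
[cite: BasuPollackRoy2006, §1.3, Notation 1.16 (PRem, Tru), pp. 21–22] -/
theorem exists_isStable_supset (S : Finset A[X]) : ∃ P : Finset A[X], S ⊆ P ∧ IsStable P := by
  classical
  set D := S.sup natDegree with hD
  have hDle : ∀ f ∈ S, f.natDegree ≤ D := fun f hf => Finset.le_sup (f := natDegree) hf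
  refine ⟨closureIter S D, fun f hf => closureIter_mono (Nat.zero_le _)
    (Finset.mem_insert_of_mem hf), fun f hf => ⟨?_, ?_, fun g hg hg0 hgf => ?_⟩⟩
  · have := (inClosure_of_mem_closureIter hf).deriv.mem_closureIter hDle
    exact closureIter_mono (Nat.sub_le _ _) this
  · have := (inClosure_of_mem_closureIter hf).erase.mem_closureIter hDle
    exact closureIter_mono (Nat.sub_le _ _) this
  · have := ((inClosure_of_mem_closureIter hf).rem (inClosure_of_mem_closureIter hg) hg0
      hgf).mem_closureIter hDle
    exact closureIter_mono (Nat.sub_le _ _) this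


/-! ### Specializations -/

/-- Erasing the leading term does not change the specialization when the leading coefficient
specializes to zero. [cite: BasuPollackRoy2006, §1.3, Notation 1.18 (specialization Q_y), p. 22] -/
theorem map_eraseLead_of_apply_leadingCoeff {S : Type*} [CommRing S] (φ : A →+* S) {p : A[X]}
    (h : φ p.leadingCoeff = 0) : (eraseLead p).map φ = p.map φ := by
  conv_rhs => rw [← eraseLead_add_monomial_natDegree_leadingCoeff p]
  rw [Polynomial.map_add, Polynomial.map_monomial, h, monomial_zero_right, add_zero]

/-- In a stable family, every member whose specialization is non-zero has the same specialization
as a member (an iterated `eraseLead`) whose leading coefficient does not specialize to zero.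
[cite: BasuPollackRoy2006, §1.3, Notation 1.18 (specialization Q_y), p. 22] -/
theorem IsStable.exists_map_eq {P : Finset A[X]} (hP : IsStable P) {S : Type*} [CommRing S]
    (φ : A →+* S) {g : A[X]} (hg : g ∈ P) (hg0 : g.map φ ≠ 0) :
    ∃ g' ∈ P, g'.map φ = g.map φ ∧ φ g'.leadingCoeff ≠ 0 ∧ g'.natDegree ≤ g.natDegree := by
  induction hn : g.natDegree using Nat.strong_induction_on generalizing g with
  | _ n ih =>
    by_cases hlc : φ g.leadingCoeff = 0
    · have hmap := map_eraseLead_of_apply_leadingCoeff φ hlc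
      rcases eraseLead_natDegree_lt_or_eraseLead_eq_zero g with hlt | h0
      · obtain ⟨g', hg'P, hmap', hlc', hdeg'⟩ :=
          ih _ (hn ▸ hlt) (hP.eraseLead_mem hg) (by rwa [hmap]) rfl
        exact ⟨g', hg'P, hmap'.trans hmap, hlc', hn ▸ hdeg'.trans hlt.le⟩
      · rw [h0, Polynomial.map_zero] at hmap
        exact absurd hmap.symm hg0
    · exact ⟨g, hg, rfl, hlc, hn ▸ le_rfl⟩

end CommRing

/-! ### Parametric sign diagrams (Cohen–Hörmander method) -/

section Param

variable {A : Type*} [CommRing A]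

/-- Sign bookkeeping: if `w = c ^ D * v` with `c ≠ 0` then `sign v = (sign c) ^ D * sign w`.
[folklore] -/
theorem sign_eq_of_eq_pow_mul {c v w : ℝ} {D : ℕ} (hc : c ≠ 0) (h : w = c ^ D * v) :
    SignType.sign v = SignType.sign c ^ D * SignType.sign w := by
  have hpos : 0 < c ^ D * c ^ D := mul_self_pos.mpr (pow_ne_zero D hc)
  calc SignType.sign v = SignType.sign (c ^ D * c ^ D * v) := by
        rw [sign_mul (c ^ D * c ^ D), sign_pos hpos, one_mul]
    _ = SignType.sign (c ^ D * w) := by rw [h, mul_assoc]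
    _ = SignType.sign c ^ D * SignType.sign w := by rw [sign_mul, sign_pow]

/-- The finite family of pairs of specializations of a family `P ⊆ A[X]` under two ring
homomorphisms `φ, ψ : A → ℝ`.
[cite: BasuPollackRoy2006, §1.3, Notation 1.18 (specialization Q_y), p. 22] -/
def specPairs (P : Finset A[X]) (φ ψ : A →+* ℝ) : Finset (ℝ[X] × ℝ[X]) :=
  P.image fun f => (f.map φ, f.map ψ)

/-- Members of `P` give pairs of specializations.
[cite: BasuPollackRoy2006, §1.3, Notation 1.18 (specialization Q_y), p. 22] -/
theorem mem_specPairs {P : Finset A[X]} {φ ψ : A →+* ℝ} {f : A[X]} (hf : f ∈ P) :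
    (f.map φ, f.map ψ) ∈ specPairs P φ ψ :=
  Finset.mem_image_of_mem _ hf

/-- The first components of `specPairs P φ ψ` are the `φ`-specializations.
[cite: BasuPollackRoy2006, §1.3, Notation 1.18 (specialization Q_y), p. 22] -/
theorem fam₁_specPairs (P : Finset A[X]) (φ ψ : A →+* ℝ) :
    fam₁ (specPairs P φ ψ) = P.image fun f => f.map φ := by
  rw [fam₁, specPairs, Finset.image_image]; rfl

/-- The second components of `specPairs P φ ψ` are the `ψ`-specializations.
[cite: BasuPollackRoy2006, §1.3, Notation 1.18 (specialization Q_y), p. 22] -/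
theorem fam₂_specPairs (P : Finset A[X]) (φ ψ : A →+* ℝ) :
    fam₂ (specPairs P φ ψ) = P.image fun f => f.map ψ := by
  rw [fam₂, specPairs, Finset.image_image]; rfl

/-- `specPairs` of an insertion.
[cite: BasuPollackRoy2006, §1.3, Notation 1.18 (specialization Q_y), p. 22] -/
theorem specPairs_insert [DecidableEq A] (P : Finset A[X]) (φ ψ : A →+* ℝ) (p : A[X]) :
    specPairs (insert p P) φ ψ = insert (p.map φ, p.map ψ) (specPairs P φ ψ) := by
  rw [specPairs, Finset.image_insert]; rfl

/-- **Root transfer.** In the inductive step (removing a member `p` of maximal positive degree from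
a stable family `P`), the signs of the two specializations of `p` agree at corresponding roots of
the smaller families: at a root `z` of `g_φ` (`g ∈ P ∖ {p}`, normalized so that its leading
coefficient does not vanish under `φ`), the pseudo-remainder identity expresses `p_φ(z)` through
the specialization of `sprem p g`, a member of `P ∖ {p}`.
[cite: BasuPollackRoy2006, §1.3, Notation 1.18 (specialization Q_y), p. 22] -/
theorem sign_map_eval_eq_of_mem_rts [DecidableEq A] {P : Finset A[X]} (hP : IsStable P)
    {φ ψ : A →+* ℝ}
    (hsign : ∀ f ∈ P, ∀ i, SignType.sign (φ (f.coeff i)) = SignType.sign (ψ (f.coeff i)))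
    {p : A[X]} (hpP : p ∈ P) (hd : 0 < p.natDegree) (hmax : ∀ f ∈ P, f.natDegree ≤ p.natDegree)
    {e : ℝ → ℝ} (he : IsCorrespondence (specPairs (P.erase p) φ ψ) e)
    {z : ℝ} (hz : z ∈ rts (fam₁ (specPairs (P.erase p) φ ψ))) :
    SignType.sign ((p.map φ).eval z) = SignType.sign ((p.map ψ).eval (e z)) := by
  set P' := P.erase p with hP'def
  have hP'sub : ∀ f ∈ P', f ∈ P := fun f hf => Finset.mem_of_mem_erase hf
  have hP' : IsStable P' := hP.erase hd hmax
  -- a member `g ∈ P'` with `g_φ ≠ 0`, `g_φ(z) = 0`, normalized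
  obtain ⟨F, hF, hF0, hFz⟩ := mem_rts.mp hz
  rw [fam₁_specPairs] at hF
  obtain ⟨g, hgP', rfl⟩ := Finset.mem_image.mp hF
  obtain ⟨g', hg'P', hmap, hlc, hdeg⟩ := hP'.exists_map_eq φ hgP' hF0
  have hg'P : g' ∈ P := hP'sub g' hg'P'
  have hm : 0 < g'.natDegree := by
    rw [← natDegree_map_of_leadingCoeff_ne_zero φ hlc, hmap]
    exact natDegree_pos_iff_degree_pos.mpr (degree_pos_of_root hF0 hFz)
  have hmp : g'.natDegree ≤ p.natDegree := hdeg.trans (hmax g (hP'sub g hgP'))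
  have hlt : (sprem p g').natDegree < p.natDegree := (natDegree_sprem_lt hm).trans_le hmp
  have hSP' : sprem p g' ∈ P' :=
    Finset.mem_erase.mpr ⟨fun h => lt_irrefl _ (h ▸ hlt), hP.sprem_mem hpP hg'P hm hmp⟩
  -- signs of the leading coefficient of `g'`
  have hslc : SignType.sign (φ g'.leadingCoeff) = SignType.sign (ψ g'.leadingCoeff) := by
    have := hsign g' hg'P g'.natDegree
    rwa [coeff_natDegree] at this
  have hlcψ : ψ g'.leadingCoeff ≠ 0 := by
    intro h0
    rw [h0, sign_zero, sign_eq_zero_iff] at hslc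
    exact hlc hslc
  -- `z` and `e z` are roots of the specializations of `g'`
  have hzφ : g'.eval₂ φ z = 0 := by rw [← eval_map, hmap]; exact hFz
  have hzψ : g'.eval₂ ψ (e z) = 0 := by
    have h1 := he.sign_root _ (mem_specPairs hg'P') z hz
    dsimp only at h1
    rw [hmap, hFz, sign_zero, eq_comm, sign_eq_zero_iff, eval_map] at h1
    exact h1
  -- pseudo-remainder identities and the correspondence for `sprem p g'`
  have hidφ := eval₂_sprem φ (p := p) hm hzφ
  have hidψ := eval₂_sprem ψ (p := p) hm hzψ
  have h2 := he.sign_root _ (mem_specPairs hSP') z hz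
  dsimp only at h2
  rw [eval_map, eval_map] at h2
  rw [eval_map, eval_map, sign_eq_of_eq_pow_mul hlc hidφ, sign_eq_of_eq_pow_mul hlcψ hidψ, h2, hslc]

/-- **Parametric sign-diagram theorem** (Cohen–Hörmander, in Muchnik's form). Let `P ⊆ A[X]` be a
finite stable family and `φ, ψ : A → ℝ` two ring homomorphisms giving the same sign to every
coefficient of every member of `P`. Then the specialized families `{f_φ}` and `{f_ψ}` have
isomorphic sign diagrams. Induction on `P`, removing a member of maximal degree.
[Bochnak–Coste–Roy 1998, proof of Thm. 2.2.1 / §1.4; Michaux–Ozturk 2002]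
[cite: BasuPollackRoy2006, Lemma 2.74 and Thm. 2.76] -/
theorem isoDiag_specPairs (φ ψ : A →+* ℝ) (P : Finset A[X]) (hP : IsStable P)
    (hsign : ∀ f ∈ P, ∀ i, SignType.sign (φ (f.coeff i)) = SignType.sign (ψ (f.coeff i))) :
    IsoDiag (specPairs P φ ψ) := by
  classical
  induction P using Finset.strongInduction with
  | H P ih =>
    by_cases hpos : ∃ f ∈ P, 0 < f.natDegree
    · obtain ⟨f₀, hf₀, hf₀d⟩ := hpos
      obtain ⟨p, hpP, hmax⟩ := Finset.exists_max_image P natDegree ⟨f₀, hf₀⟩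
      have hd : 0 < p.natDegree := hf₀d.trans_le (hmax f₀ hf₀)
      set P' := P.erase p with hP'def
      have hP' : IsStable P' := hP.erase hd hmax
      have hsub : P' ⊂ P := Finset.erase_ssubset hpP
      have hsign' : ∀ f ∈ P', ∀ i,
          SignType.sign (φ (f.coeff i)) = SignType.sign (ψ (f.coeff i)) :=
        fun f hf i => hsign f (Finset.mem_of_mem_erase hf) i
      obtain ⟨e, he⟩ := ih P' hsub hP' hsign'
      have hPins : specPairs P φ ψ = insert (p.map φ, p.map ψ) (specPairs P' φ ψ) := by
        rw [← specPairs_insert, Finset.insert_erase hpP]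
      rw [hPins]
      have hslc : SignType.sign (φ p.leadingCoeff) = SignType.sign (ψ p.leadingCoeff) := by
        have := hsign p hpP p.natDegree
        rwa [coeff_natDegree] at this
      by_cases hlc : φ p.leadingCoeff = 0
      · -- the leading coefficient vanishes under both specializations: `p` specializes like
        -- `eraseLead p ∈ P'`
        have hlc' : ψ p.leadingCoeff = 0 := by
          rw [hlc, sign_zero, eq_comm, sign_eq_zero_iff] at hslc; exact hslc
        have hE : eraseLead p ∈ P' := by
          refine Finset.mem_erase.mpr ⟨fun h => ?_, hP.eraseLead_mem hpP⟩
          rcases eraseLead_natDegree_lt_or_eraseLead_eq_zero p with hlt | h0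
          · rw [h] at hlt; exact lt_irrefl _ hlt
          · rw [h0] at h; rw [← h] at hd; simp at hd
        have hmem := mem_specPairs (φ := φ) (ψ := ψ) hE
        rw [map_eraseLead_of_apply_leadingCoeff φ hlc,
          map_eraseLead_of_apply_leadingCoeff ψ hlc'] at hmem
        rw [Finset.insert_eq_of_mem hmem]
        exact ⟨e, he⟩
      · have hlcψ : ψ p.leadingCoeff ≠ 0 := by
          intro h0
          rw [h0, sign_zero, sign_eq_zero_iff] at hslc
          exact hlc hslc
        have hder : derivative p ∈ P' := by
          refine Finset.mem_erase.mpr ⟨fun h => ?_, hP.derivative_mem hpP⟩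
          have := natDegree_derivative_lt hd.ne'
          rw [h] at this
          exact lt_irrefl _ this
        refine he.isoDiag_insert ?_ ?_ ?_ ?_ ?_ ?_
        · rw [natDegree_map_of_leadingCoeff_ne_zero φ hlc]; exact hd
        · rw [natDegree_map_of_leadingCoeff_ne_zero φ hlc,
            natDegree_map_of_leadingCoeff_ne_zero ψ hlcψ]
        · rw [leadingCoeff_map_of_leadingCoeff_ne_zero φ hlc,
            leadingCoeff_map_of_leadingCoeff_ne_zero ψ hlcψ, hslc]
        · rw [derivative_map, fam₁_specPairs]
          exact Finset.mem_image_of_mem _ hder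
        · rw [derivative_map, fam₂_specPairs]
          exact Finset.mem_image_of_mem _ hder
        · intro z hz
          exact sign_map_eval_eq_of_mem_rts hP hsign hpP hd hmax he hz
    · push Not at hpos
      refine isoDiag_of_natDegree_eq_zero fun pr hpr => ?_
      obtain ⟨f, hf, rfl⟩ := Finset.mem_image.mp hpr
      have hf0 : f.natDegree = 0 := Nat.le_zero.mp (hpos f hf)
      refine ⟨Nat.le_zero.mp (natDegree_map_le.trans hf0.le),
        Nat.le_zero.mp (natDegree_map_le.trans hf0.le), ?_⟩
      dsimp only
      rw [coeff_map, coeff_map]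
      exact hsign f hf 0

/-- **Transfer of realizable sign conditions.** Under the hypotheses of `isoDiag_specPairs`, every
simultaneous sign condition on the members of `P` realized by the `φ`-specializations at some real
point is realized by the `ψ`-specializations at some real point.
[cite: BasuPollackRoy2006, Lemma 2.74 and Thm. 2.76] -/
theorem exists_forall_sign_eval_map_eq (φ ψ : A →+* ℝ) (P : Finset A[X]) (hP : IsStable P)
    (hsign : ∀ f ∈ P, ∀ i, SignType.sign (φ (f.coeff i)) = SignType.sign (ψ (f.coeff i)))
    (y : ℝ) : ∃ y', ∀ f ∈ P,
      SignType.sign ((f.map φ).eval y) = SignType.sign ((f.map ψ).eval y') := by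
  obtain ⟨y', hy'⟩ := (isoDiag_specPairs φ ψ P hP hsign).exists_sign_eq y
  exact ⟨y', fun f hf => hy' _ (mem_specPairs hf)⟩

end Param

end SignDiagram

end Literature.ModelTheory.ExponentialFields


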